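import Literature.MathematicalPhysics.QuantumLattice.PeierlsHubbardReflectionPositivity
import Literature.MathematicalPhysics.QuantumLattice.FermionOperatorsParityProofs
import HarnessLib

/-!
# Reflection positivity for lattice fermions with BCS pair hopping (Koma 2022, Prop. 5.1 / Cor. 5.2),
# in Lieb's reflection frame

T. Koma, *Nambu–Goldstone modes for superconducting lattice fermions*, arXiv:2201.13135 (2022)
[Koma2022], §§3, 5. Koma's model (his (2.4)–(2.9), (3.1)–(3.6)) couples spin-`½` lattice fermions
with `π`-flux hopping to the **`η`-pseudospin (on-site pair) operators**

  `Γ⁺_x = c†_{x↑} c†_{x↓}`, `Γ⁻_x = c_{x↓} c_{x↑}`, `Γ¹_x = Γ⁺_x + Γ⁻_x`, `Γ²_x = i(Γ⁺_x - Γ⁻_x)`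
  [Koma2022, (3.1), (3.3)]

through the nearest-neighbour BCS pair hopping `g Σ (Γ⁺_x Γ⁻_y + Γ⁻_x Γ⁺_y) = (g/2) Σ (Γ¹_xΓ¹_y + Γ²_xΓ²_y)`
[Koma2022, (2.6), (3.2), (3.4)], and proves the existence of superconducting long-range order
(`d ≥ 3`, low temperature, Theorem 2.1) by REFLECTION POSITIVITY for fermions (Jaffe–Pedrocchi's
Majorana reflection positivity [JaffePedrocchi2015]) and Gaussian domination. The key step is
his Proposition 5.1 / Corollary 5.2: for the Hamiltonian with the Dyson–Lieb–Simon "gradient"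
field `h` in the pair interaction,

  `H_int(h) = (g/4) Σ_{x,m} [Γ¹_x ∓ Γ¹_{x+e_m} + h_m(x)]² - (g/4) Σ_{x,m} [Γ²_x ∓ Γ²_{x+e_m}]²`
  [Koma2022, (3.5), (5.42), (5.50)–(5.51)],

`(Tr e^{-βH(B,h)})² ≤ Tr e^{-βH(B,h⁻)} · Tr e^{-βH(B,h⁺)}` [Koma2022, (5.65), (5.92), (5.99)], where
`h^∓` are the field configurations reflected through the cutting plane, with ZERO field on the
bonds cut by the plane [Koma2022, (5.93)–(5.98)].

**This file proves that inequality in the reflection frame of Lieb 1994** — the frame of the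
tree's `LiebFluxPhaseRP.lean` / `PeierlsHubbardReflectionPositivity.lean` (antilinear `Θ` with
the hole–particle transformation built in, `θ(c_l) = c†_r` [Lieb1994, p. 3], realised by the
unitary `thetaMatrix` and the antilinear Dyson–Lieb–Simon trace inequality
`Matrix.norm_trace_exp_kroneckerSum_le_antiConj` [DLS1978, Lemma 4.1]). In this frame
`Θ(Γ⁺_l) = Γ⁻_r`, `Θ(Γ⁻_l) = Γ⁺_r`, hence `Θ(Γ¹_l) = Γ¹_r`, `Θ(Γ²_l) = Γ²_r`
(`antiConj_thetaT_gammaOne/Two` below), so the pair hopping is reflection positive exactly when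
it is **ferromagnetic in the `η`-pseudospin**, `-(g/2) Σ (Γ¹Γ¹ + Γ²Γ²)`, `g ≥ 0`, i.e.

  `H_pair(g, h) = (g/8) Σ_{x ∼ y (ordered)} {[Γ¹_x - Γ¹_y + h(x,y)]² + [Γ²_x - Γ²_y]²}`   (`pairInteraction`)

with the field attached to ORDERED bonds (so that the sign flip of [Koma2022, (5.93)] for bonds
along the cut direction is automatic). Relation to Koma's `H_int(h)`: by (3.4)–(3.5),
`H_int(0) = (g/2) Σ_{bonds} (Γ¹_xΓ¹_y + Γ²_xΓ²_y)` EXACTLY (the term `-(dg/2) Σ_x [(Γ¹_x)² - (Γ²_x)²]`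
of (3.4) vanishes identically, `gammaOne_sq_eq_gammaTwo_sq`), and after the `π`-rotation of the
`η`-pseudospins of the odd sublattice (conjugation by `e^{(iπ/2) Σ_{x odd} n_x}`, `Γ^{1,2}_x ↦ -Γ^{1,2}_x`
for `x` odd — the `η`-analogue of Koma's `U_{1,j}` (5.12); NOT his `Ũ₁` frame (5.50)–(5.51), where the
`Γ²` square on the bonds along the reflection direction remains a difference; the full unitary,
including the `ℤ₂` gauge, is `KomaPiFlux.komaPhase` of `KomaPiFluxPrintedModel.lean`, whose
`orbitalPhaseAut_hamiltonian_eq_printed` proves the identification stated here) it is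
`-(g/2) Σ_{bonds} (Γ¹_xΓ¹_y + Γ²_xΓ²_y) = (g/4) Σ [Γ¹_x - Γ¹_y ± h]² - (g/4) Σ [Γ²_x + Γ²_y]²`.
The present `pairInteraction g h` differs from that rotated `H_int(h)` by the ON-SITE term
`(g/2) Σ_{bonds} [(Γ²_x)² + (Γ²_y)²] = g·deg·Σ_x (Γ²_x)²` (`deg = 2(d+1)/2 = d+1` bonds per site and
orientation on the torus `(ℤ/Lℤ)^{d+1}`), and `(Γ²_x)² = (Γ¹_x)² = n_{x↑}n_{x↓} + (1-n_{x↑})(1-n_{x↓})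
= 2(n_{x↑}-½)(n_{x↓}-½) + ½` [Koma2022, (3.7)] is an (attractive-`U`) Hubbard term plus a constant:

  `pairInteraction g h = [rotated H_int(h)] + 2(d+1)g Σ_x (n_{x↑}-½)(n_{x↓}-½) + (d+1)g|Λ|/2`.

Hence KOMA'S Hamiltonian (hopping + `H_int(h)` - `B·O`, no on-site `U`) is, in this frame and up
to the additive constant `-(d+1)g|Λ|/2` (which cancels in `partitionFn_sq_le_reflected` and in
`groundEnergy_add_le_two_mul`), the case `U = -2(d+1)g` of `hamiltonian G T U g h B` below; a
model with its own on-site `U_Koma` is the case `U = U_Koma - 2(d+1)g`. The hopping part is an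
arbitrary Peierls–Hubbard Hamiltonian `peierlsHubbard G T U` of the tree in Lieb's gauge (real
nonnegative amplitudes through the cut); that Koma's `π`-flux hopping with antiperiodic boundary
conditions (2.7)–(2.9) is gauge equivalent, plane by plane, to such a `T` [Koma2022, §4.1 and
(5.22)–(5.41)] is the business of the sequel (`KomaPiFluxBCSModel.lean`) and is NOT used here.
The symmetry-breaking source `-B·O`, `O = Σ_x Γ²_x` (uniform in this frame: [Koma2022, (2.5),
(5.59)–(5.62)]) rides along.

Contents.
* `PairHopRP` (any finite graph `G` on a linearly ordered site set, any "left" predicate `p`):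
  the `η`-pseudospin operators and their algebra [Koma2022, (3.1), (3.3), (3.7)–(3.10)], the
  sourced pair Hamiltonian `hamiltonian G T U g h B`, and its Kronecker form under the splitting
  isomorphism `splitHom p` of `LiebFluxPhaseSplit.lean`: `Φ(H) = H_L ⊗ 1 + 1 ⊗ H_R + crossTerm - crossPair`
  (`splitHom_hamiltonian`), the cut bond `[Γ¹_l - Γ¹_r + φ]²` being split SYMMETRICALLY as
  `[(Γ¹_l + φ/2) ⊗ 1 - 1 ⊗ (Γ¹_r - φ/2)]²` [DLS1978, proof of Thm. 4.2] [Koma2022, (5.71)].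
* `PairHopCutRP` (the even torus `(ℤ/Lℤ)^{d+1}` cut perpendicular to coordinate `0`, the geometry
  of `FermionTorusCutPlane.lean`): `Θ(Γ^{±,1,2}_l)`, the reflected field configurations
  `fieldLL h` / `fieldRR h` (zero on the cut bonds), the DLS families, and the main results
  **`partitionFn_sq_le_reflected`** — `Z(T,h)² ≤ Z(amplLL T, fieldLL h) · Z(amplRR T, fieldRR h)`
  for `β ≥ 0`, `g ≥ 0`, real `B`, real `U`, Hermitian `T` nonnegative real through the cut —
  and its `β → ∞` form `groundEnergy_add_le_two_mul`.

WHAT THIS IS NOT: not Gaussian domination (the iteration over all planes, [Koma2022, Thm. 5.3]),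
not an infrared bound, not long-range order; nothing about the Hubbard model; Koma's Coulomb term
`g′` of (2.6) is not included (TODO(general form): `g′ Σ (n_x - 1)(n_y - 1)` is reflection
positive in the same frame, [Koma2022, §5]).

## References

* [Koma2022] T. Koma, arXiv:2201.13135, §2 (2.4)–(2.9), §3 (3.1)–(3.11), §5 (5.1)–(5.10),
  (5.42)–(5.65) (Prop. 5.1), (5.92)–(5.99) (Cor. 5.2).
* [Lieb1994] E. H. Lieb, Phys. Rev. Lett. 73 (1994) 2158, p. 3 (the reflection `Θ`), Lemma, eq. (6).
* [DLS1978] F. J. Dyson, E. H. Lieb, B. Simon, J. Stat. Phys. 18 (1978) 335, Lemma 4.1, Thm. 4.2.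
* [JaffePedrocchi2015] A. Jaffe, F. L. Pedrocchi, *Reflection positivity for Majoranas*,
  Ann. Henri Poincaré 16 (2015) 189, Thm. 6 (the fermionic reflection positivity Koma invokes).
-/

noncomputable section

namespace Literature.MathematicalPhysics.QuantumLattice

open Matrix Finset HubbardWave0 JWSplit PeierlsSplit NormedSpace
open scoped Kronecker ComplexOrder

/-! ### Kronecker helpers -/

section KroneckerHelpers

variable {m n : Type*} [Fintype m] [Fintype n] [DecidableEq m] [DecidableEq n]

/-- `(A ⊗ 1 - 1 ⊗ B)² = A² ⊗ 1 + 1 ⊗ B² - 2 A ⊗ B` (the two summands commute).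
[cite: DLS1978, proof of Thm. 4.2] -/
theorem kroneckerSub_mul_self (A : Matrix m m ℂ) (B : Matrix n n ℂ) :
    (A ⊗ₖ (1 : Matrix n n ℂ) - (1 : Matrix m m ℂ) ⊗ₖ B) * (A ⊗ₖ (1 : Matrix n n ℂ) - (1 : Matrix m m ℂ) ⊗ₖ B) =
      (A * A) ⊗ₖ (1 : Matrix n n ℂ) + (1 : Matrix m m ℂ) ⊗ₖ (B * B) - (2 : ℂ) • (A ⊗ₖ B) := by
  rw [Matrix.sub_mul, Matrix.mul_sub, Matrix.mul_sub, ← mul_kronecker_mul, ← mul_kronecker_mul,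
    ← mul_kronecker_mul, ← mul_kronecker_mul]
  simp only [Matrix.mul_one, Matrix.one_mul, two_smul]
  abel

omit [Fintype m] [Fintype n] in
/-- `(A ⊗ 1 + c) = (A + c) ⊗ 1` for a scalar `c`. [folklore] -/
private theorem kronecker_one_add_smul_one (A : Matrix m m ℂ) (c : ℂ) :
    A ⊗ₖ (1 : Matrix n n ℂ) + c • (1 : Matrix (m × n) (m × n) ℂ) =
      (A + c • (1 : Matrix m m ℂ)) ⊗ₖ (1 : Matrix n n ℂ) := by
  rw [add_kronecker, smul_kronecker, one_kronecker_one]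

omit [Fintype m] [Fintype n] in
/-- `(1 ⊗ B + c) = 1 ⊗ (B + c)` for a scalar `c`. [folklore] -/
private theorem one_kronecker_add_smul_one (B : Matrix n n ℂ) (c : ℂ) :
    (1 : Matrix m m ℂ) ⊗ₖ B + c • (1 : Matrix (m × n) (m × n) ℂ) =
      (1 : Matrix m m ℂ) ⊗ₖ (B + c • (1 : Matrix n n ℂ)) := by
  rw [kronecker_add, kronecker_smul, one_kronecker_one]

end KroneckerHelpers

namespace PairHopRP

/-! ### The `η`-pseudospin (on-site pair) operators -/

section EtaSpin

variable {Λ : Type*} [LinearOrder Λ] [Fintype Λ]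

/-- `Γ⁺_x = a†_{x↑} a†_{x↓}` — creation of an on-site pair (the matrix `GenHubbard.pairCre x` of
`EtaPairingOptimalGroundStates.lean`, restated to keep this layer free of that file's imports).
[cite: Koma2022, (3.1)] -/
def gammaPlus (x : Λ) : Matrix (Finset (Orb Λ)) (Finset (Orb Λ)) ℂ :=
  creation (orb x 0) * creation (orb x 1)

/-- `Γ⁻_x = a_{x↓} a_{x↑} = (Γ⁺_x)†` — annihilation of an on-site pair. [cite: Koma2022, (3.1)] -/
def gammaMinus (x : Λ) : Matrix (Finset (Orb Λ)) (Finset (Orb Λ)) ℂ :=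
  annihilation (orb x 1) * annihilation (orb x 0)

/-- `Γ¹_x = Γ⁺_x + Γ⁻_x`. [cite: Koma2022, (3.3)] -/
def gammaOne (x : Λ) : Matrix (Finset (Orb Λ)) (Finset (Orb Λ)) ℂ := gammaPlus x + gammaMinus x

/-- `Γ²_x = i(Γ⁺_x - Γ⁻_x)`. [cite: Koma2022, (3.3)] -/
def gammaTwo (x : Λ) : Matrix (Finset (Orb Λ)) (Finset (Orb Λ)) ℂ :=
  Complex.I • (gammaPlus x - gammaMinus x)

/-- `(Γ⁺_x)† = Γ⁻_x`. [cite: Koma2022, after (3.1)] -/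
theorem conjTranspose_gammaPlus (x : Λ) : (gammaPlus x)ᴴ = gammaMinus x := by
  rw [gammaPlus, gammaMinus, conjTranspose_mul, creation, creation, conjTranspose_conjTranspose,
    conjTranspose_conjTranspose]

/-- `(Γ⁻_x)† = Γ⁺_x`. [cite: Koma2022, after (3.1)] -/
theorem conjTranspose_gammaMinus (x : Λ) : (gammaMinus x)ᴴ = gammaPlus x := by
  rw [← conjTranspose_gammaPlus, conjTranspose_conjTranspose]

/-- `Γ¹_x` is Hermitian. [cite: Koma2022, (3.3)] -/
theorem gammaOne_isHermitian (x : Λ) : (gammaOne x).IsHermitian := by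
  rw [IsHermitian, gammaOne, conjTranspose_add, conjTranspose_gammaPlus, conjTranspose_gammaMinus,
    add_comm]

/-- `Γ²_x` is Hermitian. [cite: Koma2022, (3.3)] -/
theorem gammaTwo_isHermitian (x : Λ) : (gammaTwo x).IsHermitian := by
  rw [IsHermitian, gammaTwo, conjTranspose_smul, conjTranspose_sub, conjTranspose_gammaPlus,
    conjTranspose_gammaMinus, Complex.star_def, Complex.conj_I, neg_smul, ← smul_neg, neg_sub]

/-- `Γ⁺_x` is a real matrix. [cite: Koma2022, §5 ("the fermion operators have a real representation")] -/
theorem gammaPlus_transpose (x : Λ) : (gammaPlus x)ᵀ = (gammaPlus x)ᴴ :=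
  mul_transpose_eq_conjTranspose (creation_transpose_eq_conjTranspose _)
    (creation_transpose_eq_conjTranspose _)

/-- `Γ⁻_x` is a real matrix. [cite: Koma2022, §5 ("the fermion operators have a real representation")] -/
theorem gammaMinus_transpose (x : Λ) : (gammaMinus x)ᵀ = (gammaMinus x)ᴴ :=
  mul_transpose_eq_conjTranspose (annihilation_transpose_eq_conjTranspose _)
    (annihilation_transpose_eq_conjTranspose _)

/-- `Γ⁺_x` equals its entrywise complex conjugate. [cite: Koma2022, §5] -/
theorem gammaPlus_conjTranspose_transpose (x : Λ) : (gammaPlus x)ᴴᵀ = gammaPlus x :=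
  conjTranspose_transpose_of_transpose_eq_conjTranspose (gammaPlus_transpose x)

/-- `Γ⁻_x` equals its entrywise complex conjugate. [cite: Koma2022, §5] -/
theorem gammaMinus_conjTranspose_transpose (x : Λ) : (gammaMinus x)ᴴᵀ = gammaMinus x :=
  conjTranspose_transpose_of_transpose_eq_conjTranspose (gammaMinus_transpose x)

/-- `Γ¹_x` is a real matrix: `(Γ¹_x)‾ = Γ¹_x`. [cite: Koma2022, §5] -/
theorem gammaOne_conjTranspose_transpose (x : Λ) : (gammaOne x)ᴴᵀ = gammaOne x := by
  rw [gammaOne, conjTranspose_add, transpose_add, gammaPlus_conjTranspose_transpose,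
    gammaMinus_conjTranspose_transpose]

/-- `Γ²_x` is purely imaginary: `(Γ²_x)‾ = -Γ²_x`. [cite: Koma2022, §5 ((5.72): "pure imaginary hermitian")] -/
theorem gammaTwo_conjTranspose_transpose (x : Λ) : (gammaTwo x)ᴴᵀ = -gammaTwo x := by
  rw [gammaTwo, conjTranspose_smul, transpose_smul, conjTranspose_sub, transpose_sub,
    gammaPlus_conjTranspose_transpose, gammaMinus_conjTranspose_transpose, Complex.star_def,
    Complex.conj_I, neg_smul]

/-- `(Γ⁺_x)² = 0`. [cite: Koma2022, (3.7) (proof)] -/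
theorem gammaPlus_mul_self (x : Λ) : gammaPlus x * gammaPlus x = 0 := by
  rw [gammaPlus, Matrix.mul_assoc, ← Matrix.mul_assoc (creation (orb x 1)) (creation (orb x 0)),
    creation_mul_creation_eq_neg (orb x 1) (orb x 0), Matrix.neg_mul, Matrix.mul_assoc,
    creation_mul_self, Matrix.mul_zero, neg_zero, Matrix.mul_zero]

/-- `(Γ⁻_x)² = 0`. [cite: Koma2022, (3.7) (proof)] -/
theorem gammaMinus_mul_self (x : Λ) : gammaMinus x * gammaMinus x = 0 := by
  have h := congrArg conjTranspose (gammaPlus_mul_self x)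
  rwa [conjTranspose_mul, conjTranspose_gammaPlus, conjTranspose_zero] at h

/-- `(Γ¹_x)² = Γ⁺_xΓ⁻_x + Γ⁻_xΓ⁺_x`. [cite: Koma2022, (3.7)] -/
theorem gammaOne_mul_self (x : Λ) :
    gammaOne x * gammaOne x = gammaPlus x * gammaMinus x + gammaMinus x * gammaPlus x := by
  rw [gammaOne, Matrix.add_mul, Matrix.mul_add, Matrix.mul_add, gammaPlus_mul_self,
    gammaMinus_mul_self, zero_add, add_zero]

/-- `(Γ²_x)² = Γ⁺_xΓ⁻_x + Γ⁻_xΓ⁺_x`. [cite: Koma2022, (3.7)] -/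
theorem gammaTwo_mul_self (x : Λ) :
    gammaTwo x * gammaTwo x = gammaPlus x * gammaMinus x + gammaMinus x * gammaPlus x := by
  rw [gammaTwo, Matrix.smul_mul, Matrix.mul_smul, smul_smul, Complex.I_mul_I, Matrix.sub_mul,
    Matrix.mul_sub, Matrix.mul_sub, gammaPlus_mul_self, gammaMinus_mul_self, zero_sub, sub_zero,
    neg_smul, one_smul, neg_sub, sub_neg_eq_add, add_comm]

/-- `(Γ¹_x)² = (Γ²_x)²`: the term `-(dg/2) Σ_x [(Γ¹_x)² - (Γ²_x)²]` of [Koma2022, (3.4)–(3.5)]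
vanishes identically. [cite: Koma2022, (3.4), (3.7)] -/
theorem gammaOne_sq_eq_gammaTwo_sq (x : Λ) : gammaOne x * gammaOne x = gammaTwo x * gammaTwo x := by
  rw [gammaOne_mul_self, gammaTwo_mul_self]

/-- `Γ¹_xΓ¹_y + Γ²_xΓ²_y = 2(Γ⁺_xΓ⁻_y + Γ⁻_xΓ⁺_y)` — the BCS pair hopping in pseudospin form.
[cite: Koma2022, (3.4) (first line)] -/
theorem gammaOne_mul_gammaOne_add (x y : Λ) :
    gammaOne x * gammaOne y + gammaTwo x * gammaTwo y =
      (2 : ℂ) • (gammaPlus x * gammaMinus y + gammaMinus x * gammaPlus y) := by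
  rw [gammaOne, gammaOne, gammaTwo, gammaTwo, Matrix.smul_mul, Matrix.mul_smul, smul_smul,
    Complex.I_mul_I, Matrix.add_mul, Matrix.mul_add, Matrix.mul_add, Matrix.sub_mul, Matrix.mul_sub,
    Matrix.mul_sub, two_smul, neg_smul, one_smul]
  abel

/-! ### The sourced pair Hamiltonian on a finite graph -/

variable (G : SimpleGraph Λ) [DecidableRel G.Adj]

/-- The bond operator of the ferromagnetic `η`-pseudospin pair interaction with the
Dyson–Lieb–Simon field `φ` on the ORDERED bond `(x, y)`:
`(g/8) {[Γ¹_x - Γ¹_y + φ]² + [Γ²_x - Γ²_y]²}`. [cite: Koma2022, (3.5), (5.50)] -/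
def bondTerm (g φ : ℝ) (x y : Λ) : Matrix (Finset (Orb Λ)) (Finset (Orb Λ)) ℂ :=
  ((g / 8 : ℝ) : ℂ) •
    ((gammaOne x - gammaOne y + (φ : ℂ) • 1) * (gammaOne x - gammaOne y + (φ : ℂ) • 1) +
      (gammaTwo x - gammaTwo y) * (gammaTwo x - gammaTwo y))

/-- **The sourced pair interaction** `H_pair(g, h) = Σ_{x ∼ y} (g/8){[Γ¹_x - Γ¹_y + h(x,y)]² + [Γ²_x - Γ²_y]²}`
over ORDERED adjacent pairs (each bond twice; for an antisymmetric `h` this is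
`(g/4) Σ_{bonds} {[Γ¹_x - Γ¹_y + h]² + [Γ²_x - Γ²_y]²}`). At `h = 0` it equals
`-(g/2) Σ_{bonds}(Γ¹_xΓ¹_y + Γ²_xΓ²_y) + (g/4) Σ_{bonds}[(Γ¹_x)² + (Γ¹_y)² + (Γ²_x)² + (Γ²_y)²]`, i.e.
Koma's rotated `H_int(0) = -(g/2) Σ_{bonds}(Γ¹Γ¹ + Γ²Γ²)` PLUS the on-site term
`(g/2) Σ_x deg(x) (Γ¹_x)²` (`(Γ¹_x)² = (Γ²_x)² = 2(n_{x↑}-½)(n_{x↓}-½) + ½`, a Hubbard-`U` term and a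
constant — see the module docstring for the resulting `U`-shift `U = -2(d+1)g` on the torus); the
`h`-linear and `h²` parts agree with Koma's (3.5) for antisymmetric `h`.
[cite: Koma2022, (3.4), (3.5), (3.7), (5.50)–(5.51)] -/
def pairInteraction (g : ℝ) (h : Λ → Λ → ℝ) : Matrix (Finset (Orb Λ)) (Finset (Orb Λ)) ℂ :=
  ∑ x : Λ, ∑ y : Λ, if G.Adj x y then bondTerm g (h x y) x y else 0

/-- The superconducting order parameter in the rotated frame, `O = Σ_x Γ²_x` (Koma's staggered
`Σ_x (-1)^x Γ²_x` of (2.5) after the `π`-rotation of the odd sublattice, cf. his (5.59)).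
[cite: Koma2022, (2.5), (5.59)] -/
def orderParameter : Matrix (Finset (Orb Λ)) (Finset (Orb Λ)) ℂ := ∑ x : Λ, gammaTwo x

/-- **The Hamiltonian** `H(T, U; g, h; B) = K(T) + U Σ (n-½)(n-½) + H_pair(g, h) - B·O`:
Peierls–Hubbard hopping (tree `peierlsHubbard`), BCS pair hopping with DLS field, pairing source.
[cite: Koma2022, (2.4), (3.6)] -/
def hamiltonian (T : Fin 2 → Λ → Λ → ℂ) (U g : ℝ) (h : Λ → Λ → ℝ) (B : ℝ) :
    Matrix (Finset (Orb Λ)) (Finset (Orb Λ)) ℂ :=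
  peierlsHubbard G T U + pairInteraction G g h - (B : ℂ) • orderParameter

/-- Reversing the orientation of a bond flips the sign of its field:
`bondTerm g φ x y = bondTerm g (-φ) y x`. [cite: Koma2022, (5.93)/(5.96) (the sign flip)] -/
theorem bondTerm_swap (g φ : ℝ) (x y : Λ) : bondTerm g φ x y = bondTerm g (-φ) y x := by
  have h1 : gammaOne x - gammaOne y + (φ : ℂ) • (1 : Matrix (Finset (Orb Λ)) (Finset (Orb Λ)) ℂ) =
      -(gammaOne y - gammaOne x + ((-φ : ℝ) : ℂ) • 1) := by
    rw [Complex.ofReal_neg, neg_smul]; abel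
  have h2 : gammaTwo x - gammaTwo y = -(gammaTwo y - gammaTwo x) := (neg_sub _ _).symm
  rw [bondTerm, bondTerm, h1, h2, neg_mul_neg, neg_mul_neg]

/-- A square of a Hermitian matrix is Hermitian. [folklore] -/
private theorem isHermitian_mul_self' {k : Type*} [Fintype k] {Z : Matrix k k ℂ} (hZ : Z.IsHermitian) :
    (Z * Z).IsHermitian := by
  rw [IsHermitian, conjTranspose_mul, hZ]

/-- The bond operator is Hermitian. [cite: Koma2022, (3.5)] -/
theorem bondTerm_isHermitian (g φ : ℝ) (x y : Λ) : (bondTerm g φ x y).IsHermitian := by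
  have h1 : (gammaOne x - gammaOne y + (φ : ℂ) • (1 : Matrix (Finset (Orb Λ)) _ ℂ)).IsHermitian := by
    refine ((gammaOne_isHermitian x).sub (gammaOne_isHermitian y)).add ?_
    rw [IsHermitian, conjTranspose_smul, conjTranspose_one, Complex.star_def, Complex.conj_ofReal]
  have h2 : (gammaTwo x - gammaTwo y).IsHermitian := (gammaTwo_isHermitian x).sub (gammaTwo_isHermitian y)
  have h3 := (isHermitian_mul_self' h1).add (isHermitian_mul_self' h2)
  rw [bondTerm, IsHermitian, conjTranspose_smul, h3, Complex.star_def, Complex.conj_ofReal]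

/-- `H_pair` is Hermitian. [cite: Koma2022, (3.5)] -/
theorem pairInteraction_isHermitian (g : ℝ) (h : Λ → Λ → ℝ) : (pairInteraction G g h).IsHermitian := by
  rw [pairInteraction, IsHermitian, conjTranspose_sum]
  refine Finset.sum_congr rfl fun x _ => ?_
  rw [conjTranspose_sum]
  refine Finset.sum_congr rfl fun y _ => ?_
  split_ifs
  · exact bondTerm_isHermitian g _ x y
  · exact conjTranspose_zero

/-- `O` is Hermitian. [cite: Koma2022, (2.5)] -/
theorem orderParameter_isHermitian : (orderParameter : Matrix (Finset (Orb Λ)) _ ℂ).IsHermitian := by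
  rw [orderParameter, IsHermitian, conjTranspose_sum]
  exact Finset.sum_congr rfl fun x _ => gammaTwo_isHermitian x

/-- `H` is Hermitian for Hermitian hopping amplitudes. [cite: Koma2022, (2.4)] -/
theorem hamiltonian_isHermitian (T : Fin 2 → Λ → Λ → ℂ) (hT : ∀ σ x y, T σ y x = star (T σ x y))
    (U g : ℝ) (h : Λ → Λ → ℝ) (B : ℝ) : (hamiltonian G T U g h B).IsHermitian := by
  refine ((peierlsHubbard_isHermitian G T hT U).add (pairInteraction_isHermitian G g h)).sub ?_
  rw [IsHermitian, conjTranspose_smul, (orderParameter_isHermitian (Λ := Λ)), Complex.star_def,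
    Complex.conj_ofReal]

end EtaSpin

/-! ### Kronecker form under the splitting isomorphism `Φ = splitHom p` -/

section Split

variable {Λ : Type*} [LinearOrder Λ] [Fintype Λ] (p : Λ → Prop) [DecidablePred p]

/-- `Φ(Γ⁺_x) = Γ⁺_x ⊗ 1` for a left site. [cite: Koma2022, (5.56) (`H̃_int,± ∈ 𝒜_±`)] -/
theorem splitHom_gammaPlus_of_pos (x : Λ) (hx : p x) :
    splitHom p (gammaPlus x) =
      gammaPlus (⟨x, hx⟩ : Lsub p) ⊗ₖ (1 : Matrix (Finset (Orb (Rsub p))) _ ℂ) := by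
  rw [gammaPlus, gammaPlus, map_mul, splitHom_creation_of_pos p x 0 hx,
    splitHom_creation_of_pos p x 1 hx, ← mul_kronecker_mul, Matrix.mul_one]

/-- `Φ(Γ⁺_y) = 1 ⊗ Γ⁺_y` for a right site (the two parity factors cancel: `Γ⁺` is even).
[cite: Koma2022, (5.56)] -/
theorem splitHom_gammaPlus_of_neg (y : Λ) (hy : ¬p y) :
    splitHom p (gammaPlus y) =
      (1 : Matrix (Finset (Orb (Lsub p))) _ ℂ) ⊗ₖ gammaPlus (⟨y, hy⟩ : Rsub p) := by
  rw [gammaPlus, gammaPlus, map_mul, splitHom_creation_of_neg p y 0 hy,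
    splitHom_creation_of_neg p y 1 hy, ← mul_kronecker_mul, parityOp_mul_parityOp]

/-- `Φ(Γ⁻_x) = Γ⁻_x ⊗ 1` for a left site. [cite: Koma2022, (5.56)] -/
theorem splitHom_gammaMinus_of_pos (x : Λ) (hx : p x) :
    splitHom p (gammaMinus x) =
      gammaMinus (⟨x, hx⟩ : Lsub p) ⊗ₖ (1 : Matrix (Finset (Orb (Rsub p))) _ ℂ) := by
  rw [gammaMinus, gammaMinus, map_mul, splitHom_annihilation_of_pos p x 1 hx,
    splitHom_annihilation_of_pos p x 0 hx, ← mul_kronecker_mul, Matrix.mul_one]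

/-- `Φ(Γ⁻_y) = 1 ⊗ Γ⁻_y` for a right site. [cite: Koma2022, (5.56)] -/
theorem splitHom_gammaMinus_of_neg (y : Λ) (hy : ¬p y) :
    splitHom p (gammaMinus y) =
      (1 : Matrix (Finset (Orb (Lsub p))) _ ℂ) ⊗ₖ gammaMinus (⟨y, hy⟩ : Rsub p) := by
  rw [gammaMinus, gammaMinus, map_mul, splitHom_annihilation_of_neg p y 1 hy,
    splitHom_annihilation_of_neg p y 0 hy, ← mul_kronecker_mul, parityOp_mul_parityOp]

/-- `Φ(Γ¹_x) = Γ¹_x ⊗ 1` for a left site. [cite: Koma2022, (5.56)] -/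
theorem splitHom_gammaOne_of_pos (x : Λ) (hx : p x) :
    splitHom p (gammaOne x) =
      gammaOne (⟨x, hx⟩ : Lsub p) ⊗ₖ (1 : Matrix (Finset (Orb (Rsub p))) _ ℂ) := by
  rw [gammaOne, gammaOne, map_add, splitHom_gammaPlus_of_pos p x hx, splitHom_gammaMinus_of_pos p x hx,
    add_kronecker]

/-- `Φ(Γ¹_y) = 1 ⊗ Γ¹_y` for a right site. [cite: Koma2022, (5.56)] -/
theorem splitHom_gammaOne_of_neg (y : Λ) (hy : ¬p y) :
    splitHom p (gammaOne y) =
      (1 : Matrix (Finset (Orb (Lsub p))) _ ℂ) ⊗ₖ gammaOne (⟨y, hy⟩ : Rsub p) := by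
  rw [gammaOne, gammaOne, map_add, splitHom_gammaPlus_of_neg p y hy, splitHom_gammaMinus_of_neg p y hy,
    kronecker_add]

/-- `Φ(Γ²_x) = Γ²_x ⊗ 1` for a left site. [cite: Koma2022, (5.56)] -/
theorem splitHom_gammaTwo_of_pos (x : Λ) (hx : p x) :
    splitHom p (gammaTwo x) =
      gammaTwo (⟨x, hx⟩ : Lsub p) ⊗ₖ (1 : Matrix (Finset (Orb (Rsub p))) _ ℂ) := by
  rw [gammaTwo, gammaTwo, map_smul, map_sub, splitHom_gammaPlus_of_pos p x hx,
    splitHom_gammaMinus_of_pos p x hx, ← sub_kronecker, smul_kronecker]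

/-- `Φ(Γ²_y) = 1 ⊗ Γ²_y` for a right site. [cite: Koma2022, (5.56)] -/
theorem splitHom_gammaTwo_of_neg (y : Λ) (hy : ¬p y) :
    splitHom p (gammaTwo y) =
      (1 : Matrix (Finset (Orb (Lsub p))) _ ℂ) ⊗ₖ gammaTwo (⟨y, hy⟩ : Rsub p) := by
  rw [gammaTwo, gammaTwo, map_smul, map_sub, splitHom_gammaPlus_of_neg p y hy,
    splitHom_gammaMinus_of_neg p y hy, ← kronecker_sub, kronecker_smul]

/-- The field-shifted difference of two LEFT pseudospins stays on the left. [cite: Koma2022, (5.56)] -/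
theorem splitHom_fieldDiff_LL (φ : ℝ) (x y : Λ) (hx : p x) (hy : p y) :
    splitHom p (gammaOne x - gammaOne y + (φ : ℂ) • 1) =
      (gammaOne (⟨x, hx⟩ : Lsub p) - gammaOne (⟨y, hy⟩ : Lsub p) + (φ : ℂ) • 1) ⊗ₖ
        (1 : Matrix (Finset (Orb (Rsub p))) _ ℂ) := by
  rw [map_add, map_sub, map_smul, splitHom_gammaOne_of_pos p x hx, splitHom_gammaOne_of_pos p y hy,
    splitHom_one, ← sub_kronecker, ← smul_kronecker, ← add_kronecker]

/-- The field-shifted difference of two RIGHT pseudospins stays on the right. [cite: Koma2022, (5.56)] -/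
theorem splitHom_fieldDiff_RR (φ : ℝ) (x y : Λ) (hx : ¬p x) (hy : ¬p y) :
    splitHom p (gammaOne x - gammaOne y + (φ : ℂ) • 1) =
      (1 : Matrix (Finset (Orb (Lsub p))) _ ℂ) ⊗ₖ
        (gammaOne (⟨x, hx⟩ : Rsub p) - gammaOne (⟨y, hy⟩ : Rsub p) + (φ : ℂ) • 1) := by
  rw [map_add, map_sub, map_smul, splitHom_gammaOne_of_neg p x hx, splitHom_gammaOne_of_neg p y hy,
    splitHom_one, ← kronecker_sub, ← kronecker_smul, ← kronecker_add]

/-- **The symmetric splitting of the field on a cut bond**: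
`Γ¹_l ⊗ 1 - 1 ⊗ Γ¹_r + φ = (Γ¹_l + φ/2) ⊗ 1 - 1 ⊗ (Γ¹_r - φ/2)`.
[cite: DLS1978, proof of Thm. 4.2] [cite: Koma2022, (5.71)] -/
theorem splitHom_fieldDiff_LR (φ : ℝ) (x y : Λ) (hx : p x) (hy : ¬p y) :
    splitHom p (gammaOne x - gammaOne y + (φ : ℂ) • 1) =
      (gammaOne (⟨x, hx⟩ : Lsub p) + ((φ / 2 : ℝ) : ℂ) • 1) ⊗ₖ (1 : Matrix (Finset (Orb (Rsub p))) _ ℂ) -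
        (1 : Matrix (Finset (Orb (Lsub p))) _ ℂ) ⊗ₖ (gammaOne (⟨y, hy⟩ : Rsub p) + ((-φ / 2 : ℝ) : ℂ) • 1) := by
  rw [map_add, map_sub, map_smul, splitHom_gammaOne_of_pos p x hx, splitHom_gammaOne_of_neg p y hy,
    map_one, add_kronecker, kronecker_add, smul_kronecker, kronecker_smul, one_kronecker_one]
  push_cast
  module

/-- The difference of the `Γ²`'s across the cut. [cite: Koma2022, (5.57)] -/
theorem splitHom_gammaTwo_sub_LR (x y : Λ) (hx : p x) (hy : ¬p y) :
    splitHom p (gammaTwo x - gammaTwo y) =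
      gammaTwo (⟨x, hx⟩ : Lsub p) ⊗ₖ (1 : Matrix (Finset (Orb (Rsub p))) _ ℂ) -
        (1 : Matrix (Finset (Orb (Lsub p))) _ ℂ) ⊗ₖ gammaTwo (⟨y, hy⟩ : Rsub p) := by
  rw [map_sub, splitHom_gammaTwo_of_pos p x hx, splitHom_gammaTwo_of_neg p y hy]

/-- `Φ` of a left–left bond term. [cite: Koma2022, (5.56)] -/
theorem splitHom_bondTerm_LL (g φ : ℝ) (x y : Λ) (hx : p x) (hy : p y) :
    splitHom p (bondTerm g φ x y) =
      bondTerm g φ (⟨x, hx⟩ : Lsub p) (⟨y, hy⟩ : Lsub p) ⊗ₖ (1 : Matrix (Finset (Orb (Rsub p))) _ ℂ) := by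
  rw [bondTerm, bondTerm, map_smul, map_add, map_mul, map_mul, splitHom_fieldDiff_LL p φ x y hx hy,
    map_sub, splitHom_gammaTwo_of_pos p x hx, splitHom_gammaTwo_of_pos p y hy, ← sub_kronecker,
    ← mul_kronecker_mul, ← mul_kronecker_mul, Matrix.mul_one, ← add_kronecker, smul_kronecker]

/-- `Φ` of a right–right bond term. [cite: Koma2022, (5.56)] -/
theorem splitHom_bondTerm_RR (g φ : ℝ) (x y : Λ) (hx : ¬p x) (hy : ¬p y) :
    splitHom p (bondTerm g φ x y) =
      (1 : Matrix (Finset (Orb (Lsub p))) _ ℂ) ⊗ₖ bondTerm g φ (⟨x, hx⟩ : Rsub p) (⟨y, hy⟩ : Rsub p) := by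
  rw [bondTerm, bondTerm, map_smul, map_add, map_mul, map_mul, splitHom_fieldDiff_RR p φ x y hx hy,
    map_sub, splitHom_gammaTwo_of_neg p x hx, splitHom_gammaTwo_of_neg p y hy, ← kronecker_sub,
    ← mul_kronecker_mul, ← mul_kronecker_mul, Matrix.mul_one, ← kronecker_add, kronecker_smul]

/-- **The half-bond operator left on one side of a cut bond**:
`(g/8){[Γ¹_x + φ/2]² + [Γ²_x]²}`. [cite: DLS1978, proof of Thm. 4.2] [cite: Koma2022, (5.71), (5.73)] -/
def halfBond (g φ : ℝ) (x : Λ) : Matrix (Finset (Orb Λ)) (Finset (Orb Λ)) ℂ :=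
  ((g / 8 : ℝ) : ℂ) •
    ((gammaOne x + ((φ / 2 : ℝ) : ℂ) • 1) * (gammaOne x + ((φ / 2 : ℝ) : ℂ) • 1) + gammaTwo x * gammaTwo x)

/-- The half-bond operator is Hermitian. [cite: Koma2022, (3.5)] -/
theorem halfBond_isHermitian (g φ : ℝ) (x : Λ) : (halfBond g φ x).IsHermitian := by
  have h1 : (gammaOne x + ((φ / 2 : ℝ) : ℂ) • (1 : Matrix (Finset (Orb Λ)) _ ℂ)).IsHermitian := by
    refine (gammaOne_isHermitian x).add ?_
    rw [IsHermitian, conjTranspose_smul, conjTranspose_one, Complex.star_def, Complex.conj_ofReal]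
  have h3 := (isHermitian_mul_self' h1).add (isHermitian_mul_self' (gammaTwo_isHermitian x))
  rw [halfBond, IsHermitian, conjTranspose_smul, h3, Complex.star_def, Complex.conj_ofReal]

/-- **The crossing letters of a cut bond** `(l, r)` with field `φ`:
`(g/4){(Γ¹_l + φ/2) ⊗ (Γ¹_r - φ/2) + Γ²_l ⊗ Γ²_r}`. [cite: DLS1978, proof of Thm. 4.2] [cite: Koma2022, (5.74)–(5.78)] -/
def crossLetter (g φ : ℝ) (a : Lsub p) (b : Rsub p) :
    Matrix (Finset (Orb (Lsub p)) × Finset (Orb (Rsub p)))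
      (Finset (Orb (Lsub p)) × Finset (Orb (Rsub p))) ℂ :=
  ((g / 4 : ℝ) : ℂ) •
    ((gammaOne a + ((φ / 2 : ℝ) : ℂ) • 1) ⊗ₖ (gammaOne b + ((-φ / 2 : ℝ) : ℂ) • 1) +
      gammaTwo a ⊗ₖ gammaTwo b)

/-- **`Φ` of a CUT bond term**: two half-bonds and the crossing letters,
`Φ((g/8){[Γ¹_l - Γ¹_r + φ]² + [Γ²_l - Γ²_r]²}) = halfBond_l(φ) ⊗ 1 + 1 ⊗ halfBond_r(-φ) - crossLetter(φ)`.
[cite: DLS1978, proof of Thm. 4.2] [cite: Koma2022, (5.69)–(5.78)] -/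
theorem splitHom_bondTerm_LR (g φ : ℝ) (x y : Λ) (hx : p x) (hy : ¬p y) :
    splitHom p (bondTerm g φ x y) =
      halfBond g φ (⟨x, hx⟩ : Lsub p) ⊗ₖ (1 : Matrix (Finset (Orb (Rsub p))) _ ℂ) +
        (1 : Matrix (Finset (Orb (Lsub p))) _ ℂ) ⊗ₖ halfBond g (-φ) (⟨y, hy⟩ : Rsub p) -
        crossLetter p g φ ⟨x, hx⟩ ⟨y, hy⟩ := by
  rw [bondTerm, map_smul, map_add, map_mul, map_mul, splitHom_fieldDiff_LR p φ x y hx hy,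
    splitHom_gammaTwo_sub_LR p x y hx hy, kroneckerSub_mul_self, kroneckerSub_mul_self, halfBond,
    halfBond, crossLetter]
  have hc : ((g / 4 : ℝ) : ℂ) = ((g / 8 : ℝ) : ℂ) * 2 := by push_cast; ring
  rw [hc, neg_div, smul_kronecker, kronecker_smul]
  simp only [smul_add, smul_sub, add_kronecker, kronecker_add, smul_smul]
  ring_nf
  abel

end Split

/-! ### `Φ(H) = H_L ⊗ 1 + 1 ⊗ H_R + crossTerm - crossPair` -/

section SplitHamiltonian

variable {Λ : Type*} [LinearOrder Λ] [Fintype Λ] (p : Λ → Prop) [DecidablePred p]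
  (G : SimpleGraph Λ) [DecidableRel G.Adj]

/-- The half-bonds left on the LEFT side by the cut bonds (both orientations of each cut bond:
field `h(l,r)` and `-h(r,l)`). [cite: DLS1978, proof of Thm. 4.2] [cite: Koma2022, (5.57)] -/
def leftBoundary (g : ℝ) (h : Λ → Λ → ℝ) : Matrix (Finset (Orb (Lsub p))) (Finset (Orb (Lsub p))) ℂ :=
  ∑ a : Lsub p, ∑ b : Rsub p,
    if G.Adj a.1 b.1 then halfBond g (h a.1 b.1) a + halfBond g (-h b.1 a.1) a else 0

/-- The half-bonds left on the RIGHT side by the cut bonds. [cite: DLS1978, proof of Thm. 4.2] [cite: Koma2022, (5.57)] -/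
def rightBoundary (g : ℝ) (h : Λ → Λ → ℝ) : Matrix (Finset (Orb (Rsub p))) (Finset (Orb (Rsub p))) ℂ :=
  ∑ a : Lsub p, ∑ b : Rsub p,
    if G.Adj a.1 b.1 then halfBond g (-h a.1 b.1) b + halfBond g (h b.1 a.1) b else 0

/-- **The crossing part of the pair interaction** (to be SUBTRACTED): the letters of all cut bonds,
both orientations. [cite: DLS1978, proof of Thm. 4.2] [cite: Koma2022, (5.57), (5.74)] -/
def crossPair (g : ℝ) (h : Λ → Λ → ℝ) :
    Matrix (Finset (Orb (Lsub p)) × Finset (Orb (Rsub p)))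
      (Finset (Orb (Lsub p)) × Finset (Orb (Rsub p))) ℂ :=
  ∑ a : Lsub p, ∑ b : Rsub p,
    if G.Adj a.1 b.1 then crossLetter p g (h a.1 b.1) a b + crossLetter p g (-h b.1 a.1) a b else 0

/-- **`H_pair,L`**: the pair interaction of the left half plus the left half-bonds of the cut.
[cite: Koma2022, (5.55)–(5.57)] -/
def leftPair (g : ℝ) (h : Λ → Λ → ℝ) : Matrix (Finset (Orb (Lsub p))) (Finset (Orb (Lsub p))) ℂ :=
  pairInteraction (leftGraph p G) g (fun a b => h a.1 b.1) + leftBoundary p G g h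

/-- **`H_pair,R`**: the pair interaction of the right half plus the right half-bonds of the cut.
[cite: Koma2022, (5.55)–(5.57)] -/
def rightPair (g : ℝ) (h : Λ → Λ → ℝ) : Matrix (Finset (Orb (Rsub p))) (Finset (Orb (Rsub p))) ℂ :=
  pairInteraction (rightGraph p G) g (fun a b => h a.1 b.1) + rightBoundary p G g h

/-- **`H_L`** of the full model: hopping and `U` of the left half (tree `leftHamiltonian`), left pair
part, source `-B Σ_{x ∈ L} Γ²_x`. [cite: Koma2022, (5.63)] -/
def leftTotal (T : Fin 2 → Λ → Λ → ℂ) (U g : ℝ) (h : Λ → Λ → ℝ) (B : ℝ) :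
    Matrix (Finset (Orb (Lsub p))) (Finset (Orb (Lsub p))) ℂ :=
  leftHamiltonian p G T U + leftPair p G g h - (B : ℂ) • orderParameter

/-- **`H_R`** of the full model. [cite: Koma2022, (5.63)] -/
def rightTotal (T : Fin 2 → Λ → Λ → ℂ) (U g : ℝ) (h : Λ → Λ → ℝ) (B : ℝ) :
    Matrix (Finset (Orb (Rsub p))) (Finset (Orb (Rsub p))) ℂ :=
  rightHamiltonian p G T U + rightPair p G g h - (B : ℂ) • orderParameter

/-- `Φ(O) = O_L ⊗ 1 + 1 ⊗ O_R`. [cite: Koma2022, (5.59)–(5.61)] -/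
theorem splitHom_orderParameter :
    splitHom p (orderParameter : Matrix (Finset (Orb Λ)) _ ℂ) =
      (orderParameter : Matrix (Finset (Orb (Lsub p))) _ ℂ) ⊗ₖ (1 : Matrix (Finset (Orb (Rsub p))) _ ℂ) +
        (1 : Matrix (Finset (Orb (Lsub p))) _ ℂ) ⊗ₖ (orderParameter : Matrix (Finset (Orb (Rsub p))) _ ℂ) := by
  rw [orderParameter, orderParameter, orderParameter, map_sum, sum_eq_sum_add_sum p, sum_kronecker,
    kronecker_sum]
  congr 1
  · exact Finset.sum_congr rfl fun a _ => splitHom_gammaTwo_of_pos p a.1 a.2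
  · exact Finset.sum_congr rfl fun b _ => splitHom_gammaTwo_of_neg p b.1 b.2

/-- **`Φ(H_pair) = H_pair,L ⊗ 1 + 1 ⊗ H_pair,R - crossPair`.** [cite: Koma2022, (5.55)–(5.57)] -/
theorem splitHom_pairInteraction (g : ℝ) (h : Λ → Λ → ℝ) :
    splitHom p (pairInteraction G g h) =
      leftPair p G g h ⊗ₖ (1 : Matrix (Finset (Orb (Rsub p))) _ ℂ) +
        (1 : Matrix (Finset (Orb (Lsub p))) _ ℂ) ⊗ₖ rightPair p G g h - crossPair p G g h := by
  set F : Λ → Λ → Matrix (Finset (Orb Λ)) (Finset (Orb Λ)) ℂ := fun x y =>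
    if G.Adj x y then bondTerm g (h x y) x y else 0 with hF
  have hsplit : ∀ x y, splitHom p (F x y) = if G.Adj x y then splitHom p (bondTerm g (h x y) x y) else 0 := by
    intro x y
    rw [hF]
    dsimp only
    split_ifs
    · rfl
    · exact map_zero _
  -- LL block
  have hLL : ∑ a : Lsub p, ∑ a' : Lsub p, splitHom p (F a.1 a'.1) =
      pairInteraction (leftGraph p G) g (fun a b => h a.1 b.1) ⊗ₖ (1 : Matrix (Finset (Orb (Rsub p))) _ ℂ) := by
    rw [pairInteraction, sum_kronecker]
    refine Finset.sum_congr rfl fun a _ => ?_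
    rw [sum_kronecker]
    refine Finset.sum_congr rfl fun a' _ => ?_
    rw [hsplit, ite_kronecker]
    by_cases hadj : G.Adj a.1 a'.1
    · rw [if_pos hadj, if_pos (show (leftGraph p G).Adj a a' from hadj)]
      exact splitHom_bondTerm_LL p g _ a.1 a'.1 a.2 a'.2
    · rw [if_neg hadj, if_neg (show ¬(leftGraph p G).Adj a a' from hadj)]
  -- RR block
  have hRR : ∑ b : Rsub p, ∑ b' : Rsub p, splitHom p (F b.1 b'.1) =
      (1 : Matrix (Finset (Orb (Lsub p))) _ ℂ) ⊗ₖ pairInteraction (rightGraph p G) g (fun a b => h a.1 b.1) := by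
    rw [pairInteraction, kronecker_sum]
    refine Finset.sum_congr rfl fun b _ => ?_
    rw [kronecker_sum]
    refine Finset.sum_congr rfl fun b' _ => ?_
    rw [hsplit, kronecker_ite]
    by_cases hadj : G.Adj b.1 b'.1
    · rw [if_pos hadj, if_pos (show (rightGraph p G).Adj b b' from hadj)]
      exact splitHom_bondTerm_RR p g _ b.1 b'.1 b.2 b'.2
    · rw [if_neg hadj, if_neg (show ¬(rightGraph p G).Adj b b' from hadj)]
  -- LR + RL blocks
  have hLRRL : ∑ a : Lsub p, ∑ b : Rsub p, splitHom p (F a.1 b.1) +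
      ∑ b : Rsub p, ∑ a : Lsub p, splitHom p (F b.1 a.1) =
      leftBoundary p G g h ⊗ₖ (1 : Matrix (Finset (Orb (Rsub p))) _ ℂ) +
        (1 : Matrix (Finset (Orb (Lsub p))) _ ℂ) ⊗ₖ rightBoundary p G g h - crossPair p G g h := by
    rw [Finset.sum_comm (f := fun (b : Rsub p) (a : Lsub p) => splitHom p (F b.1 a.1)),
      ← Finset.sum_add_distrib, leftBoundary, rightBoundary, crossPair, sum_kronecker, kronecker_sum,
      ← Finset.sum_add_distrib, ← Finset.sum_sub_distrib]
    refine Finset.sum_congr rfl fun a _ => ?_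
    rw [← Finset.sum_add_distrib, sum_kronecker, kronecker_sum, ← Finset.sum_add_distrib,
      ← Finset.sum_sub_distrib]
    refine Finset.sum_congr rfl fun b _ => ?_
    rw [hsplit, hsplit]
    by_cases hadj : G.Adj a.1 b.1
    · have hba : G.Adj b.1 a.1 := (G.adj_comm _ _).1 hadj
      simp only [if_pos hadj, if_pos hba]
      rw [bondTerm_swap g (h b.1 a.1) b.1 a.1,
        splitHom_bondTerm_LR p g _ a.1 b.1 a.2 b.2, splitHom_bondTerm_LR p g _ a.1 b.1 a.2 b.2, neg_neg,
        add_kronecker, kronecker_add]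
      abel
    · have hba : ¬G.Adj b.1 a.1 := fun h' => hadj ((G.adj_comm _ _).1 h')
      simp only [if_neg hadj, if_neg hba, zero_kronecker, kronecker_zero, add_zero, sub_zero]
  -- assemble
  have hexp : pairInteraction G g h = ∑ x : Λ, ∑ y : Λ, F x y := rfl
  rw [hexp, map_sum, sum_eq_sum_add_sum p]
  simp only [map_sum]
  have e1 : ∀ x : Λ, ∑ y : Λ, splitHom p (F x y) =
      ∑ a' : Lsub p, splitHom p (F x a'.1) + ∑ b' : Rsub p, splitHom p (F x b'.1) :=
    fun x => sum_eq_sum_add_sum p _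
  simp only [e1, Finset.sum_add_distrib]
  rw [hLL, hRR, eq_sub_of_add_eq hLRRL, leftPair, rightPair, add_kronecker, kronecker_add]
  abel

/-- **Koma's decomposition `H̃ = H̃₋ + H̃₊ + H̃₀` in Kronecker form** for the full model:
`Φ(H) = H_L ⊗ 1 + 1 ⊗ H_R + crossTerm(T) - crossPair(g,h)`. [cite: Koma2022, (5.63)–(5.64)] -/
theorem splitHom_hamiltonian (T : Fin 2 → Λ → Λ → ℂ) (U g : ℝ) (h : Λ → Λ → ℝ) (B : ℝ) :
    splitHom p (hamiltonian G T U g h B) =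
      leftTotal p G T U g h B ⊗ₖ (1 : Matrix (Finset (Orb (Rsub p))) _ ℂ) +
        (1 : Matrix (Finset (Orb (Lsub p))) _ ℂ) ⊗ₖ rightTotal p G T U g h B +
        crossTerm p G T - crossPair p G g h := by
  rw [hamiltonian, map_sub, map_add, map_smul, splitHom_peierlsHubbard, splitHom_pairInteraction,
    splitHom_orderParameter, leftTotal, rightTotal, smul_add, sub_kronecker, kronecker_sub,
    add_kronecker, kronecker_add, smul_kronecker, kronecker_smul]
  abel

/-- `H_L` is Hermitian (for Hermitian `T`). [cite: Koma2022, (5.63)] -/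
theorem leftTotal_isHermitian (T : Fin 2 → Λ → Λ → ℂ) (hT : ∀ σ x y, T σ y x = star (T σ x y))
    (U g : ℝ) (h : Λ → Λ → ℝ) (B : ℝ) : (leftTotal p G T U g h B).IsHermitian := by
  have hbd : (leftBoundary p G g h).IsHermitian := by
    rw [leftBoundary, IsHermitian, conjTranspose_sum]
    refine Finset.sum_congr rfl fun a _ => ?_
    rw [conjTranspose_sum]
    refine Finset.sum_congr rfl fun b _ => ?_
    split_ifs
    · rw [conjTranspose_add, (halfBond_isHermitian _ _ _).eq, (halfBond_isHermitian _ _ _).eq]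
    · exact conjTranspose_zero
  refine (((peierlsHubbard_isHermitian _ _ (fun σ a b => hT σ a.1 b.1) U).add
    ((pairInteraction_isHermitian _ g _).add hbd)).sub ?_)
  rw [IsHermitian, conjTranspose_smul, (orderParameter_isHermitian (Λ := Lsub p)).eq, Complex.star_def,
    Complex.conj_ofReal]

/-- `H_R` is Hermitian (for Hermitian `T`). [cite: Koma2022, (5.63)] -/
theorem rightTotal_isHermitian (T : Fin 2 → Λ → Λ → ℂ) (hT : ∀ σ x y, T σ y x = star (T σ x y))
    (U g : ℝ) (h : Λ → Λ → ℝ) (B : ℝ) : (rightTotal p G T U g h B).IsHermitian := by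
  have hbd : (rightBoundary p G g h).IsHermitian := by
    rw [rightBoundary, IsHermitian, conjTranspose_sum]
    refine Finset.sum_congr rfl fun a _ => ?_
    rw [conjTranspose_sum]
    refine Finset.sum_congr rfl fun b _ => ?_
    split_ifs
    · rw [conjTranspose_add, (halfBond_isHermitian _ _ _).eq, (halfBond_isHermitian _ _ _).eq]
    · exact conjTranspose_zero
  refine (((peierlsHubbard_isHermitian _ _ (fun σ a b => hT σ a.1 b.1) U).add
    ((pairInteraction_isHermitian _ g _).add hbd)).sub ?_)
  rw [IsHermitian, conjTranspose_smul, (orderParameter_isHermitian (Λ := Rsub p)).eq, Complex.star_def,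
    Complex.conj_ofReal]

end SplitHamiltonian

/-! ### Congruence in the field -/

section Congr

variable {Λ : Type*} [LinearOrder Λ] [Fintype Λ] (G : SimpleGraph Λ) [DecidableRel G.Adj]

/-- `H_pair` only sees the field on adjacent ordered pairs. [cite: Koma2022, (3.5)] -/
theorem pairInteraction_congr {g : ℝ} {h h' : Λ → Λ → ℝ} (hh : ∀ x y, G.Adj x y → h x y = h' x y) :
    pairInteraction G g h = pairInteraction G g h' := by
  rw [pairInteraction, pairInteraction]
  refine Finset.sum_congr rfl fun x _ => Finset.sum_congr rfl fun y _ => ?_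
  split_ifs with hxy
  · rw [hh x y hxy]
  · rfl

end Congr

/-! ### `J_V` on differences (complement to `LiebFluxPhaseDLS`) -/

section AntiConj

variable {m n : Type*} [Fintype m] [Fintype n] [DecidableEq m] [DecidableEq n]

omit [Fintype n] [DecidableEq m] [DecidableEq n] in
/-- `J_V(X - Y) = J_V(X) - J_V(Y)` (the antilinear `Θ` is additive). [cite: Lieb1994, p. 3 (definition of `Θ`)] -/
theorem antiConj_sub' (V : Matrix n m ℂ) (X Y : Matrix m m ℂ) :
    antiConj V (X - Y) = antiConj V X - antiConj V Y := by
  simp [antiConj, conjTranspose_sub, transpose_sub, Matrix.mul_sub, Matrix.sub_mul]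

omit [Fintype n] [DecidableEq m] [DecidableEq n] in
/-- `J_V(-X) = -J_V(X)`. [cite: Lieb1994, p. 3 (definition of `Θ`)] -/
theorem antiConj_neg' (V : Matrix n m ℂ) (X : Matrix m m ℂ) : antiConj V (-X) = -antiConj V X := by
  simp [antiConj, conjTranspose_neg, transpose_neg]

end AntiConj

end PairHopRP

/-! ## The even torus cut by a plane: `Θ`, reflected fields, DLS families, the inequality -/

namespace PairHopCutRP

open FermionTorus.Cut PairHopRP LiebCutRP

attribute [local instance] LiebCutRP.decEqTorus

variable {d L : ℕ} [NeZero L]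

/-! ### `Θ` on the pseudospin operators -/

/-- `P c† = -c† P`: a creation operator is odd. [folklore] -/
private theorem parityOp_mul_creation' {ι : Type*} [LinearOrder ι] [Fintype ι] (i : ι) :
    (parityOp : Matrix (Finset ι) (Finset ι) ℂ) * creation i = -(creation i * parityOp) := by
  have h := congrArg conjTranspose (parityOp_mul_annihilation_holds (ι := ι) i)
  rw [conjTranspose_mul, conjTranspose_neg, conjTranspose_mul, parityOp_conjTranspose] at h
  -- `h : c† P = -(P c†)`
  rw [← creation] at h
  rw [h, neg_neg]

/-- `c_i c_j = -c_j c_i`. [folklore] -/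
private theorem annihilation_mul_annihilation_eq_neg' {ι : Type*} [LinearOrder ι] [Fintype ι] (i j : ι) :
    (annihilation i * annihilation j : Matrix (Finset ι) (Finset ι) ℂ) = -(annihilation j * annihilation i) :=
  eq_neg_of_add_eq_zero_left (annihilation_anticommute_holds i j)

omit [NeZero L] in
/-- **`Θ(Γ⁺_l) = Γ⁻_r`**: `V Γ⁺_l Vᴴ = Γ⁻_{Rl}` (from `θ(c_l) = c†_r`). [cite: Lieb1994, p. 3] [cite: Koma2022, (5.1)–(5.2)] -/
theorem thetaT_conj_gammaPlus (hL : Even L) (a : LS d L) :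
    thetaT d hL * gammaPlus a * (thetaT d hL)ᴴ = gammaMinus (leftEquivRight hL a) := by
  have hsplit : gammaPlus a =
      -((creation (orb a 0) * parityOp) * (creation (orb a 1) * parityOp) :
        Matrix (Finset (Orb (LS d L))) _ ℂ) := by
    rw [gammaPlus, Matrix.mul_assoc, ← Matrix.mul_assoc parityOp, parityOp_mul_creation',
      Matrix.neg_mul, Matrix.mul_neg, Matrix.mul_assoc, parityOp_mul_parityOp, Matrix.mul_one]
    exact (neg_neg _).symm
  rw [hsplit, Matrix.mul_neg, Matrix.neg_mul, thetaMatrix_conj_mul,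
    thetaMatrix_conj_creation_mul_parityOp, thetaMatrix_conj_creation_mul_parityOp, orbReflect_orb,
    orbReflect_orb, annihilation_mul_annihilation_eq_neg', neg_neg, gammaMinus]

omit [NeZero L] in
/-- **`Θ(Γ⁻_l) = Γ⁺_r`.** [cite: Lieb1994, p. 3] [cite: Koma2022, (5.1)–(5.2)] -/
theorem thetaT_conj_gammaMinus (hL : Even L) (a : LS d L) :
    thetaT d hL * gammaMinus a * (thetaT d hL)ᴴ = gammaPlus (leftEquivRight hL a) := by
  rw [← conjTranspose_gammaPlus, thetaMatrix_conj_conjTranspose, thetaT_conj_gammaPlus,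
    conjTranspose_gammaMinus]

omit [NeZero L] in
/-- `J_V(Γ⁺_l) = Γ⁻_r` (the `Γ`'s are real). [cite: Koma2022, (5.1)–(5.2)] -/
theorem antiConj_thetaT_gammaPlus (hL : Even L) (a : LS d L) :
    antiConj (thetaT d hL) (gammaPlus a) = gammaMinus (leftEquivRight hL a) := by
  rw [antiConj_def, gammaPlus_conjTranspose_transpose, thetaT_conj_gammaPlus]

omit [NeZero L] in
/-- `J_V(Γ⁻_l) = Γ⁺_r`. [cite: Koma2022, (5.1)–(5.2)] -/
theorem antiConj_thetaT_gammaMinus (hL : Even L) (a : LS d L) :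
    antiConj (thetaT d hL) (gammaMinus a) = gammaPlus (leftEquivRight hL a) := by
  rw [antiConj_def, gammaMinus_conjTranspose_transpose, thetaT_conj_gammaMinus]

omit [NeZero L] in
/-- **`Θ(Γ¹_l) = Γ¹_r`.** [cite: Koma2022, (5.81)] -/
theorem antiConj_thetaT_gammaOne (hL : Even L) (a : LS d L) :
    antiConj (thetaT d hL) (gammaOne a) = gammaOne (leftEquivRight hL a) := by
  rw [gammaOne, antiConj_add, antiConj_thetaT_gammaPlus, antiConj_thetaT_gammaMinus, gammaOne, add_comm]

omit [NeZero L] in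
/-- **`Θ(Γ²_l) = Γ²_r`** (antilinearity compensates the sign `Θ(Γ⁺ - Γ⁻) = -(Γ⁺ - Γ⁻)`; in Koma's
frame without the hole–particle twist this reads `ϑ(Γ²) = -Γ²`, his (5.81)).
[cite: Koma2022, (5.81)] [cite: Lieb1994, p. 3] -/
theorem antiConj_thetaT_gammaTwo (hL : Even L) (a : LS d L) :
    antiConj (thetaT d hL) (gammaTwo a) = gammaTwo (leftEquivRight hL a) := by
  rw [gammaTwo, antiConj_smul, antiConj_sub', antiConj_thetaT_gammaPlus, antiConj_thetaT_gammaMinus,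
    gammaTwo, Complex.star_def, Complex.conj_I, neg_smul, ← smul_neg, neg_sub]

omit [NeZero L] in
/-- `J_V` of a field-shifted pseudospin: `Θ(Γ¹_l + c) = Γ¹_r + c` (`c` real). [cite: Koma2022, (5.81)] -/
theorem antiConj_thetaT_gammaOne_add (hL : Even L) (a : LS d L) (c : ℝ) :
    antiConj (thetaT d hL) (gammaOne a + (c : ℂ) • 1) = gammaOne (leftEquivRight hL a) + (c : ℂ) • 1 := by
  rw [antiConj_add, antiConj_thetaT_gammaOne, antiConj_ofReal_smul,
    antiConj_one (thetaMatrix_mul_conjTranspose _)]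

omit [NeZero L] in
/-- `Θ` of a half-bond: `Θ(halfBond(φ)_l) = halfBond(φ)_r`. [cite: Koma2022, (5.80)–(5.81)] -/
theorem antiConj_thetaT_halfBond (hL : Even L) (g φ : ℝ) (a : LS d L) :
    antiConj (thetaT d hL) (halfBond g φ a) = halfBond g φ (leftEquivRight hL a) := by
  have hV : (thetaT d hL)ᴴ * thetaT d hL = 1 := conjTranspose_thetaMatrix_mul_self _
  rw [halfBond, halfBond, antiConj_ofReal_smul, antiConj_add, antiConj_mul hV, antiConj_mul hV,
    antiConj_thetaT_gammaOne_add, antiConj_thetaT_gammaTwo]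

omit [NeZero L] in
/-- `Θ` of a bond term of the left half: the mirror bond with the SAME field on the mirrored
ordered pair. [cite: Koma2022, (5.95)/(5.98)] -/
theorem antiConj_thetaT_bondTerm (hL : Even L) (g φ : ℝ) (a a' : LS d L) :
    antiConj (thetaT d hL) (bondTerm g φ a a') =
      bondTerm g φ (leftEquivRight hL a) (leftEquivRight hL a') := by
  have hV : (thetaT d hL)ᴴ * thetaT d hL = 1 := conjTranspose_thetaMatrix_mul_self _
  rw [bondTerm, bondTerm, antiConj_ofReal_smul, antiConj_add, antiConj_mul hV, antiConj_mul hV,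
    antiConj_add, antiConj_sub', antiConj_sub', antiConj_thetaT_gammaOne, antiConj_thetaT_gammaOne,
    antiConj_thetaT_gammaTwo, antiConj_thetaT_gammaTwo, antiConj_ofReal_smul,
    antiConj_one (thetaMatrix_mul_conjTranspose _)]

omit [NeZero L] in
/-- `Θ(O_L) = O_R`. [cite: Koma2022, (5.62)] -/
theorem antiConj_thetaT_orderParameter (hL : Even L) :
    antiConj (thetaT d hL) (orderParameter : Matrix (Finset (Orb (LS d L))) _ ℂ) =
      (orderParameter : Matrix (Finset (Orb (RS d L))) _ ℂ) := by
  rw [orderParameter, orderParameter, antiConj_sum, ← (leftEquivRight (d := d) hL).sum_comp]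
  exact Finset.sum_congr rfl fun a _ => antiConj_thetaT_gammaTwo hL a

/-- **`Θ(H_pair,L(h)) = H_pair,R(h ∘ R)`**: the pair interaction of the left half goes to the pair
interaction of the right half with the field transported by the reflection,
`h⁺(x, y) = h(Rx, Ry)`. [cite: Koma2022, (5.95), (5.98)] -/
theorem antiConj_thetaT_pairInteraction (hL : Even L) (h2 : 2 ≤ L) (g : ℝ)
    (h : FermionTorus (d + 1) L → FermionTorus (d + 1) L → ℝ) :
    antiConj (thetaT d hL) (pairInteraction (leftGraph (IsLeft L) (G d L)) g (fun a a' => h a.1 a'.1)) =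
      pairInteraction (rightGraph (IsLeft L) (G d L)) g (fun b b' => h (reflect b.1) (reflect b'.1)) := by
  set e := leftEquivRight (d := d) (L := L) hL with he
  rw [pairInteraction, pairInteraction, antiConj_sum, ← e.sum_comp]
  refine Finset.sum_congr rfl fun a _ => ?_
  rw [antiConj_sum, ← e.sum_comp]
  refine Finset.sum_congr rfl fun a' _ => ?_
  have hadj : (rightGraph (IsLeft L) (G d L)).Adj (e a) (e a') ↔
      (leftGraph (IsLeft L) (G d L)).Adj a a' := by
    simp only [SimpleGraph.comap_adj, Function.Embedding.coe_subtype, he, leftEquivRight_apply]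
    rw [adj_reflect_iff h2]
  by_cases hA : (leftGraph (IsLeft L) (G d L)).Adj a a'
  · rw [if_pos hA, if_pos (hadj.2 hA), antiConj_thetaT_bondTerm]
    simp only [he, leftEquivRight_apply, reflect_reflect]
  · rw [if_neg hA, if_neg (fun h' => hA (hadj.1 h')), antiConj_zero]

/-! ### The boundary sums on the torus: one cut bond per boundary site -/

section Boundary

variable (hL : Even L) (h4 : 4 ≤ L)
include hL h4

/-- On the torus the left half-bonds of the cut sit at the boundary sites:
`leftBoundary = Σ_{l ∈ ∂} [halfBond(h(l,Rl))_l + halfBond(-h(Rl,l))_l]`. [cite: Koma2022, (5.57)] -/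
theorem leftBoundary_eq (g : ℝ) (h : FermionTorus (d + 1) L → FermionTorus (d + 1) L → ℝ) :
    leftBoundary (IsLeft L) (G d L) g h =
      ∑ a : LS d L, if IsBoundary L a.1 then
        halfBond g (h a.1 (reflect a.1)) a + halfBond g (-h (reflect a.1) a.1) a else 0 := by
  rw [leftBoundary]
  refine Finset.sum_congr rfl fun a _ => ?_
  rw [sum_right_adj_eq hL h4 a (fun b => halfBond g (h a.1 b.1) a + halfBond g (-h b.1 a.1) a)]
  rfl

/-- The right half-bonds of the cut: `rightBoundary = Σ_{l ∈ ∂} [halfBond(-h(l,Rl))_{Rl} + halfBond(h(Rl,l))_{Rl}]`.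
[cite: Koma2022, (5.57)] -/
theorem rightBoundary_eq (g : ℝ) (h : FermionTorus (d + 1) L → FermionTorus (d + 1) L → ℝ) :
    rightBoundary (IsLeft L) (G d L) g h =
      ∑ a : LS d L, if IsBoundary L a.1 then
        halfBond g (-h a.1 (reflect a.1)) (leftEquivRight hL a) +
          halfBond g (h (reflect a.1) a.1) (leftEquivRight hL a) else 0 := by
  rw [rightBoundary]
  refine Finset.sum_congr rfl fun a _ => ?_
  rw [sum_right_adj_eq hL h4 a (fun b => halfBond g (-h a.1 b.1) b + halfBond g (h b.1 a.1) b)]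
  rfl

/-- The crossing letters of the cut: `crossPair = Σ_{l ∈ ∂} [crossLetter(h(l,Rl)) + crossLetter(-h(Rl,l))]`.
[cite: Koma2022, (5.57), (5.74)] -/
theorem crossPair_eq (g : ℝ) (h : FermionTorus (d + 1) L → FermionTorus (d + 1) L → ℝ) :
    crossPair (IsLeft L) (G d L) g h =
      ∑ a : LS d L, if IsBoundary L a.1 then
        crossLetter (IsLeft L) g (h a.1 (reflect a.1)) a (leftEquivRight hL a) +
          crossLetter (IsLeft L) g (-h (reflect a.1) a.1) a (leftEquivRight hL a) else 0 := by
  rw [crossPair]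
  refine Finset.sum_congr rfl fun a _ => ?_
  rw [sum_right_adj_eq hL h4 a (fun b => crossLetter (IsLeft L) g (h a.1 b.1) a b +
    crossLetter (IsLeft L) g (-h b.1 a.1) a b)]
  rfl

end Boundary

/-! ### The reflected field configurations -/

/-- **`h_LL`**: the field kept on the left bonds, transported by `R` to the right bonds
(`h_LL(x,y) = h(Rx,Ry)` for `x, y` right), and ZERO on the cut bonds.
[cite: Koma2022, (5.96)–(5.98)] -/
def fieldLL (h : FermionTorus (d + 1) L → FermionTorus (d + 1) L → ℝ) :
    FermionTorus (d + 1) L → FermionTorus (d + 1) L → ℝ := fun x y =>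
  if ¬IsLeft L x ∧ ¬IsLeft L y then h (reflect x) (reflect y)
  else if IsLeft L x ∧ IsLeft L y then h x y else 0

/-- **`h_RR`**: the field kept on the right bonds, transported by `R` to the left bonds, and ZERO
on the cut bonds. [cite: Koma2022, (5.93)–(5.95)] -/
def fieldRR (h : FermionTorus (d + 1) L → FermionTorus (d + 1) L → ℝ) :
    FermionTorus (d + 1) L → FermionTorus (d + 1) L → ℝ := fun x y =>
  if IsLeft L x ∧ IsLeft L y then h (reflect x) (reflect y)
  else if ¬IsLeft L x ∧ ¬IsLeft L y then h x y else 0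

omit [NeZero L] in
/-- `h_LL = h` on left pairs. [cite: Koma2022, (5.96)] -/
theorem fieldLL_of_left (h : FermionTorus (d + 1) L → FermionTorus (d + 1) L → ℝ)
    {x y : FermionTorus (d + 1) L} (hx : IsLeft L x) (hy : IsLeft L y) : fieldLL h x y = h x y := by
  simp [fieldLL, hx, hy]

omit [NeZero L] in
/-- `h_LL = h ∘ R` on right pairs. [cite: Koma2022, (5.98)] -/
theorem fieldLL_of_right (h : FermionTorus (d + 1) L → FermionTorus (d + 1) L → ℝ)
    {x y : FermionTorus (d + 1) L} (hx : ¬IsLeft L x) (hy : ¬IsLeft L y) :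
    fieldLL h x y = h (reflect x) (reflect y) := by
  simp [fieldLL, hx, hy]

omit [NeZero L] in
/-- `h_LL = 0` across the cut. [cite: Koma2022, (5.97)] -/
theorem fieldLL_of_cut (h : FermionTorus (d + 1) L → FermionTorus (d + 1) L → ℝ)
    {x y : FermionTorus (d + 1) L} (hx : IsLeft L x) (hy : ¬IsLeft L y) :
    fieldLL h x y = 0 ∧ fieldLL h y x = 0 := by
  constructor <;> simp [fieldLL, hx, hy]

omit [NeZero L] in
/-- `h_RR = h` on right pairs. [cite: Koma2022, (5.93)] -/
theorem fieldRR_of_right (h : FermionTorus (d + 1) L → FermionTorus (d + 1) L → ℝ)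
    {x y : FermionTorus (d + 1) L} (hx : ¬IsLeft L x) (hy : ¬IsLeft L y) : fieldRR h x y = h x y := by
  simp [fieldRR, hx, hy]

omit [NeZero L] in
/-- `h_RR = h ∘ R` on left pairs. [cite: Koma2022, (5.95)] -/
theorem fieldRR_of_left (h : FermionTorus (d + 1) L → FermionTorus (d + 1) L → ℝ)
    {x y : FermionTorus (d + 1) L} (hx : IsLeft L x) (hy : IsLeft L y) :
    fieldRR h x y = h (reflect x) (reflect y) := by
  simp [fieldRR, hx, hy]

omit [NeZero L] in
/-- `h_RR = 0` across the cut. [cite: Koma2022, (5.94)] -/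
theorem fieldRR_of_cut (h : FermionTorus (d + 1) L → FermionTorus (d + 1) L → ℝ)
    {x y : FermionTorus (d + 1) L} (hx : IsLeft L x) (hy : ¬IsLeft L y) :
    fieldRR h x y = 0 ∧ fieldRR h y x = 0 := by
  constructor <;> simp [fieldRR, hx, hy]

/-! ### The DLS letters of the pair interaction -/

/-- The left letter with field shift `ψ/2`: `√(βg/4)(Γ¹_l + ψ/2)` (`k = true`) or `√(βg/4) Γ²_l`
(`k = false`). [cite: Koma2022, (5.78)] [cite: DLS1978, proof of Thm. 4.2] -/
def Mletter (β g ψ : ℝ) (a : LS d L) (k : Bool) : Matrix (Finset (Orb (LS d L))) (Finset (Orb (LS d L))) ℂ :=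
  bif k then (Real.sqrt (β * (g / 4)) : ℂ) • (gammaOne a + ((ψ / 2 : ℝ) : ℂ) • 1)
  else (Real.sqrt (β * (g / 4)) : ℂ) • gammaTwo a

/-- The right letter with field shift `ψ/2` at the mirror site. [cite: Koma2022, (5.78), (5.80)] -/
def Nletter (hL : Even L) (β g ψ : ℝ) (a : LS d L) (k : Bool) :
    Matrix (Finset (Orb (RS d L))) (Finset (Orb (RS d L))) ℂ :=
  bif k then (Real.sqrt (β * (g / 4)) : ℂ) • (gammaOne (leftEquivRight hL a) + ((ψ / 2 : ℝ) : ℂ) • 1)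
  else (Real.sqrt (β * (g / 4)) : ℂ) • gammaTwo (leftEquivRight hL a)

omit [NeZero L] in
/-- **`J_V(M_ψ) = N_ψ`**: the right letter is the reflection of the left letter with the SAME shift
(so `M_φ ⊗ N_{-φ}`, the actual crossing letter, is `M ⊗ Θ(M)` only at `φ = 0`).
[cite: Koma2022, (5.80)] [cite: DLS1978, proof of Thm. 4.2] -/
theorem antiConj_thetaT_Mletter (hL : Even L) (β g ψ : ℝ) (a : LS d L) (k : Bool) :
    antiConj (thetaT d hL) (Mletter β g ψ a k) = Nletter hL β g ψ a k := by
  cases k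
  · simp only [Mletter, Nletter, cond_false]
    rw [antiConj_ofReal_smul, antiConj_thetaT_gammaTwo]
  · simp only [Mletter, Nletter, cond_true]
    rw [antiConj_ofReal_smul, antiConj_thetaT_gammaOne_add]

/-- The field of the letter of the cut bond at `l` with orientation `o`:
`φ = h(l, Rl)` (`o = true`) or `φ = -h(Rl, l)` (`o = false`). [cite: Koma2022, (5.57)] -/
def letterField (h : FermionTorus (d + 1) L → FermionTorus (d + 1) L → ℝ) (a : LS d L) (o : Bool) : ℝ :=
  bif o then h a.1 (reflect a.1) else -h (reflect a.1) a.1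

/-- Index of the pair letters: boundary site, orientation, component. [cite: Koma2022, (5.74)–(5.78)] -/
abbrev PCutIdx (d L : ℕ) : Type := {a : LS d L // IsBoundary L a.1} × Bool × Bool

/-- The left DLS family of the pair interaction, `M_i = M_{φ_i}`. [cite: Koma2022, (5.75), (5.78)] -/
def Mpair (β g : ℝ) (h : FermionTorus (d + 1) L → FermionTorus (d + 1) L → ℝ) (i : PCutIdx d L) :
    Matrix (Finset (Orb (LS d L))) (Finset (Orb (LS d L))) ℂ :=
  Mletter β g (letterField h i.1.1 i.2.1) i.1.1 i.2.2

/-- The right DLS family of the pair interaction, `N_i = N_{-φ_i}`. [cite: Koma2022, (5.76), (5.80)] -/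
def Npair (hL : Even L) (β g : ℝ) (h : FermionTorus (d + 1) L → FermionTorus (d + 1) L → ℝ)
    (i : PCutIdx d L) : Matrix (Finset (Orb (RS d L))) (Finset (Orb (RS d L))) ℂ :=
  Nletter hL β g (-letterField h i.1.1 i.2.1) i.1.1 i.2.2

omit [NeZero L] in
/-- **The crossing letters are the DLS products**: for `βg ≥ 0`,
`Σ_k M_ψ(k) ⊗ N_{ψ'}(k) = (βg/4){(Γ¹_l + ψ/2) ⊗ (Γ¹_{Rl} + ψ'/2) + Γ²_l ⊗ Γ²_{Rl}}`.
[cite: Koma2022, (5.74)–(5.78)] -/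
theorem sum_Mletter_kronecker_Nletter (hL : Even L) {β g : ℝ} (hβg : 0 ≤ β * (g / 4)) (ψ ψ' : ℝ)
    (a : LS d L) :
    ∑ k : Bool, Mletter β g ψ a k ⊗ₖ Nletter hL β g ψ' a k =
      ((β * (g / 4) : ℝ) : ℂ) •
        ((gammaOne a + ((ψ / 2 : ℝ) : ℂ) • 1) ⊗ₖ (gammaOne (leftEquivRight hL a) + ((ψ' / 2 : ℝ) : ℂ) • 1) +
          gammaTwo a ⊗ₖ gammaTwo (leftEquivRight hL a)) := by
  have hr : ((Real.sqrt (β * (g / 4)) : ℂ)) * (Real.sqrt (β * (g / 4)) : ℂ) = ((β * (g / 4) : ℝ) : ℂ) := by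
    rw [← Complex.ofReal_mul, Real.mul_self_sqrt hβg]
  rw [Fintype.sum_bool]
  simp only [Mletter, Nletter, cond_true, cond_false]
  rw [smul_kronecker_smul, smul_kronecker_smul, hr, ← smul_add]

/-! ### The total of one oriented cut bond, and the cancellation of the field shifts -/

/-- The crossing operator of a cut bond with independent shifts on the two sides:
`(Γ¹_l + ψ_L/2) ⊗ (Γ¹_{Rl} + ψ_R/2) + Γ²_l ⊗ Γ²_{Rl}`. [cite: DLS1978, proof of Thm. 4.2] [cite: Koma2022, (5.78)–(5.80)] -/
def cross (hL : Even L) (ψL ψR : ℝ) (a : LS d L) :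
    Matrix (Finset (Orb (LS d L)) × Finset (Orb (RS d L)))
      (Finset (Orb (LS d L)) × Finset (Orb (RS d L))) ℂ :=
  (gammaOne a + ((ψL / 2 : ℝ) : ℂ) • 1) ⊗ₖ (gammaOne (leftEquivRight hL a) + ((ψR / 2 : ℝ) : ℂ) • 1) +
    gammaTwo a ⊗ₖ gammaTwo (leftEquivRight hL a)

/-- **The total of one oriented cut bond** in `Φ(-βH)`: the two half-bonds (shifts `ψ_L/2`,
`ψ_R/2`) and the crossing, `-β halfBond(ψ_L)_l ⊗ 1 - β 1 ⊗ halfBond(ψ_R)_{Rl} + (βg/4) cross(ψ_L, ψ_R)`.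
For the original Hamiltonian `(ψ_L, ψ_R) = (φ, -φ)`; for the comparison systems `(φ, φ)`.
[cite: DLS1978, proof of Thm. 4.2] [cite: Koma2022, (5.69)–(5.78)] -/
def letterTotal (hL : Even L) (β g ψL ψR : ℝ) (a : LS d L) :
    Matrix (Finset (Orb (LS d L)) × Finset (Orb (RS d L)))
      (Finset (Orb (LS d L)) × Finset (Orb (RS d L))) ℂ :=
  ((-(β : ℂ)) • halfBond g ψL a) ⊗ₖ (1 : Matrix (Finset (Orb (RS d L))) _ ℂ) +
    (1 : Matrix (Finset (Orb (LS d L))) _ ℂ) ⊗ₖ ((-(β : ℂ)) • halfBond g ψR (leftEquivRight hL a)) +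
    ((β * (g / 4) : ℝ) : ℂ) • cross hL ψL ψR a

omit [NeZero L] in
/-- **The cancellation**: with EQUAL shifts on both sides the field drops out of the bond total,
`letterTotal(c, c) = letterTotal(0, 0)` — i.e. `-(βg/8)[(Γ¹_l + c/2) ⊗ 1 - 1 ⊗ (Γ¹_r + c/2)]² = -(βg/8)[Γ¹_l ⊗ 1 - 1 ⊗ Γ¹_r]²`:
the reflected systems carry ZERO field on the cut bonds. [cite: Koma2022, (5.94), (5.97)] [cite: DLS1978, proof of Thm. 4.2] -/
theorem letterTotal_diag (hL : Even L) (β g c : ℝ) (a : LS d L) :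
    letterTotal hL β g c c a = letterTotal hL β g 0 0 a := by
  simp only [letterTotal, halfBond, cross, Matrix.add_mul, Matrix.mul_add, Matrix.smul_mul,
    Matrix.mul_smul, Matrix.mul_one, Matrix.one_mul, smul_add, add_kronecker, kronecker_add,
    smul_kronecker, kronecker_smul, one_kronecker_one, smul_smul, zero_div, Complex.ofReal_zero,
    zero_smul, add_zero]
  push_cast
  module

omit [NeZero L] in
/-- Regrouping the three boundary sums into bond totals. [cite: DLS1978, proof of Thm. 4.2] -/
theorem boundary_regroup (hL : Even L) (β g : ℝ) (ψL ψR : LS d L → Bool → ℝ) :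
    ((-(β : ℂ)) • ∑ a : LS d L, if IsBoundary L a.1 then ∑ o : Bool, halfBond g (ψL a o) a else 0) ⊗ₖ
        (1 : Matrix (Finset (Orb (RS d L))) _ ℂ) +
      (1 : Matrix (Finset (Orb (LS d L))) _ ℂ) ⊗ₖ ((-(β : ℂ)) • ∑ a : LS d L,
        if IsBoundary L a.1 then ∑ o : Bool, halfBond g (ψR a o) (leftEquivRight hL a) else 0) +
      ∑ a : LS d L, (if IsBoundary L a.1 then
        ∑ o : Bool, ((β * (g / 4) : ℝ) : ℂ) • cross hL (ψL a o) (ψR a o) a else 0) =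
    ∑ a : LS d L, if IsBoundary L a.1 then ∑ o : Bool, letterTotal hL β g (ψL a o) (ψR a o) a else 0 := by
  rw [Finset.smul_sum, Finset.smul_sum, sum_kronecker, kronecker_sum, ← Finset.sum_add_distrib,
    ← Finset.sum_add_distrib]
  refine Finset.sum_congr rfl fun a _ => ?_
  split_ifs
  · rw [Finset.smul_sum, Finset.smul_sum, sum_kronecker, kronecker_sum, ← Finset.sum_add_distrib,
      ← Finset.sum_add_distrib]
    refine Finset.sum_congr rfl fun o _ => ?_
    rw [letterTotal]
  · rw [smul_zero, smul_zero, zero_kronecker, kronecker_zero, add_zero, add_zero]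

/-! ### The standard DLS form of `Φ(-βH)` -/

/-- The left core: hopping and `U` of the left half, left pair interaction with field `h`, source.
[cite: Koma2022, (5.63)] -/
def coreL (T : Fin 2 → FermionTorus (d + 1) L → FermionTorus (d + 1) L → ℂ) (U g : ℝ)
    (h : FermionTorus (d + 1) L → FermionTorus (d + 1) L → ℝ) (B : ℝ) :
    Matrix (Finset (Orb (LS d L))) (Finset (Orb (LS d L))) ℂ :=
  leftHamiltonian (IsLeft L) (G d L) T U +
    pairInteraction (leftGraph (IsLeft L) (G d L)) g (fun a b => h a.1 b.1) - (B : ℂ) • orderParameter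

/-- The right core. [cite: Koma2022, (5.63)] -/
def coreR (T : Fin 2 → FermionTorus (d + 1) L → FermionTorus (d + 1) L → ℂ) (U g : ℝ)
    (h : FermionTorus (d + 1) L → FermionTorus (d + 1) L → ℝ) (B : ℝ) :
    Matrix (Finset (Orb (RS d L))) (Finset (Orb (RS d L))) ℂ :=
  rightHamiltonian (IsLeft L) (G d L) T U +
    pairInteraction (rightGraph (IsLeft L) (G d L)) g (fun a b => h a.1 b.1) - (B : ℂ) • orderParameter

omit [NeZero L] in
/-- `H_L = coreL + leftBoundary`. [cite: Koma2022, (5.63)] -/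
theorem leftTotal_eq (T : Fin 2 → FermionTorus (d + 1) L → FermionTorus (d + 1) L → ℂ) (U g : ℝ)
    (h : FermionTorus (d + 1) L → FermionTorus (d + 1) L → ℝ) (B : ℝ) :
    leftTotal (IsLeft L) (G d L) T U g h B = coreL T U g h B + leftBoundary (IsLeft L) (G d L) g h := by
  rw [leftTotal, coreL, leftPair]
  abel

omit [NeZero L] in
/-- `H_R = coreR + rightBoundary`. [cite: Koma2022, (5.63)] -/
theorem rightTotal_eq (T : Fin 2 → FermionTorus (d + 1) L → FermionTorus (d + 1) L → ℂ) (U g : ℝ)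
    (h : FermionTorus (d + 1) L → FermionTorus (d + 1) L → ℝ) (B : ℝ) :
    rightTotal (IsLeft L) (G d L) T U g h B = coreR T U g h B + rightBoundary (IsLeft L) (G d L) g h := by
  rw [rightTotal, coreR, rightPair]
  abel

/-- **The standard Dyson–Lieb–Simon form**
`A ⊗ 1 + 1 ⊗ B + Σᵢ Mᵢ ⊗ Nᵢ` of `Φ(-βH)`, with the cut bonds written as bond totals with shifts
`(ψ_L, ψ_R)`. [cite: DLS1978, Lemma 4.1, Thm. 4.2] [cite: Koma2022, (5.63)–(5.64), (5.74)] -/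
def dlsForm (hL : Even L) (β : ℝ) (tc : Fin 2 → FermionTorus (d + 1) L → ℝ)
    (T : Fin 2 → FermionTorus (d + 1) L → FermionTorus (d + 1) L → ℂ) (U g : ℝ)
    (hl hr : FermionTorus (d + 1) L → FermionTorus (d + 1) L → ℝ) (B : ℝ) (ψL ψR : LS d L → Bool → ℝ) :
    Matrix (Finset (Orb (LS d L)) × Finset (Orb (RS d L)))
      (Finset (Orb (LS d L)) × Finset (Orb (RS d L))) ℂ :=
  ((-(β : ℂ)) • coreL T U g hl B) ⊗ₖ (1 : Matrix (Finset (Orb (RS d L))) _ ℂ) +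
    (1 : Matrix (Finset (Orb (LS d L))) _ ℂ) ⊗ₖ ((-(β : ℂ)) • coreR T U g hr B) +
    ∑ i : CutIdx d L, Mfam β tc i ⊗ₖ Nfam hL β tc i +
    ∑ a : LS d L, if IsBoundary L a.1 then ∑ o : Bool, letterTotal hL β g (ψL a o) (ψR a o) a else 0

omit [NeZero L] in
/-- The DLS form depends on the fields only through the left pairs, the right pairs and the bond
totals. [cite: DLS1978, proof of Thm. 4.2] -/
theorem dlsForm_congr (hL : Even L) (β : ℝ) (tc : Fin 2 → FermionTorus (d + 1) L → ℝ)
    (T : Fin 2 → FermionTorus (d + 1) L → FermionTorus (d + 1) L → ℂ) (U g : ℝ)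
    {hl hr hl' hr' : FermionTorus (d + 1) L → FermionTorus (d + 1) L → ℝ} (B : ℝ)
    {ψL ψR ψL' ψR' : LS d L → Bool → ℝ}
    (hhl : ∀ x y, IsLeft L x → IsLeft L y → hl x y = hl' x y)
    (hhr : ∀ x y, ¬IsLeft L x → ¬IsLeft L y → hr x y = hr' x y)
    (hψ : ∀ a : LS d L, IsBoundary L a.1 → ∀ o,
      letterTotal hL β g (ψL a o) (ψR a o) a = letterTotal hL β g (ψL' a o) (ψR' a o) a) :
    dlsForm hL β tc T U g hl hr B ψL ψR = dlsForm hL β tc T U g hl' hr' B ψL' ψR' := by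
  have e1 : coreL T U g hl B = (coreL T U g hl' B : Matrix (Finset (Orb (LS d L))) _ ℂ) := by
    rw [coreL, coreL, pairInteraction_congr (leftGraph (IsLeft L) (G d L))
      (h := fun a b => hl a.1 b.1) (h' := fun a b => hl' a.1 b.1) (fun a b _ => hhl a.1 b.1 a.2 b.2)]
  have e2 : coreR T U g hr B = (coreR T U g hr' B : Matrix (Finset (Orb (RS d L))) _ ℂ) := by
    rw [coreR, coreR, pairInteraction_congr (rightGraph (IsLeft L) (G d L))
      (h := fun a b => hr a.1 b.1) (h' := fun a b => hr' a.1 b.1) (fun a b _ => hhr a.1 b.1 a.2 b.2)]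
  have e3 : (∑ a : LS d L, if IsBoundary L a.1 then ∑ o : Bool, letterTotal hL β g (ψL a o) (ψR a o) a else 0) =
      ∑ a : LS d L, if IsBoundary L a.1 then ∑ o : Bool, letterTotal hL β g (ψL' a o) (ψR' a o) a else 0 := by
    refine Finset.sum_congr rfl fun a _ => ?_
    split_ifs with hb
    · exact Finset.sum_congr rfl fun o _ => hψ a hb o
    · rfl
  rw [dlsForm, dlsForm, e1, e2, e3]

section Decomposition

variable (hL : Even L) (h4 : 4 ≤ L)
include hL h4

/-- `-β` times the hopping cross term is the hopping DLS sum. [cite: Lieb1994, proof of the Lemma] -/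
theorem neg_smul_crossTerm {β : ℝ} {tc : Fin 2 → FermionTorus (d + 1) L → ℝ}
    (hβt : ∀ σ x, IsBoundary L x → 0 ≤ β * tc σ x)
    (T : Fin 2 → FermionTorus (d + 1) L → FermionTorus (d + 1) L → ℂ)
    (hcut : ∀ σ x, IsBoundary L x → T σ x (reflect x) = tc σ x ∧ T σ (reflect x) x = tc σ x) :
    (-(β : ℂ)) • crossTerm (IsLeft L) (G d L) T = ∑ i : CutIdx d L, Mfam β tc i ⊗ₖ Nfam hL β tc i := by
  rw [crossTerm_eq hL h4 T tc hcut, sum_Mfam_kronecker_Nfam hL hβt, smul_neg, ← neg_smul, neg_neg,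
    Finset.smul_sum]
  refine Finset.sum_congr rfl fun a _ => ?_
  rw [Finset.smul_sum]
  refine Finset.sum_congr rfl fun σ _ => ?_
  split_ifs
  · rw [smul_smul, Complex.ofReal_mul]
  · rw [smul_zero]

/-- **`Φ(-βH(T; g, h; B))` in standard DLS form**, the cut bonds with shifts `(φ, -φ)`,
`φ` the field of the oriented cut bond. [cite: Koma2022, (5.63)–(5.64), (5.69)] [cite: DLS1978, proof of Thm. 4.2] -/
theorem splitHom_neg_smul_hamiltonian {β : ℝ} {tc : Fin 2 → FermionTorus (d + 1) L → ℝ}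
    (hβt : ∀ σ x, IsBoundary L x → 0 ≤ β * tc σ x) (U g : ℝ)
    (T : Fin 2 → FermionTorus (d + 1) L → FermionTorus (d + 1) L → ℂ)
    (hcut : ∀ σ x, IsBoundary L x → T σ x (reflect x) = tc σ x ∧ T σ (reflect x) x = tc σ x)
    (h : FermionTorus (d + 1) L → FermionTorus (d + 1) L → ℝ) (B : ℝ) :
    splitHom (IsLeft L) ((-(β : ℂ)) • PairHopRP.hamiltonian (G d L) T U g h B) =
      dlsForm hL β tc T U g h h B (fun a o => letterField h a o) (fun a o => -letterField h a o) := by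
  have hs : splitHom (IsLeft L) ((-(β : ℂ)) • PairHopRP.hamiltonian (G d L) T U g h B) =
      (-(β : ℂ)) • splitHom (IsLeft L) (PairHopRP.hamiltonian (G d L) T U g h B) :=
    (splitHom (IsLeft L)).toLinearEquiv.map_smul _ _
  -- the boundary half-bonds and the pair crossing, regrouped into bond totals
  have eL : leftBoundary (IsLeft L) (G d L) g h =
      ∑ a : LS d L, if IsBoundary L a.1 then ∑ o : Bool, halfBond g (letterField h a o) a else 0 := by
    rw [leftBoundary_eq hL h4]
    refine Finset.sum_congr rfl fun a _ => ?_
    split_ifs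
    · rw [Fintype.sum_bool]; rfl
    · rfl
  have eR : rightBoundary (IsLeft L) (G d L) g h =
      ∑ a : LS d L, if IsBoundary L a.1 then
        ∑ o : Bool, halfBond g (-letterField h a o) (leftEquivRight hL a) else 0 := by
    rw [rightBoundary_eq hL h4]
    refine Finset.sum_congr rfl fun a _ => ?_
    split_ifs
    · rw [Fintype.sum_bool]
      simp only [letterField, cond_true, cond_false, neg_neg]
    · rfl
  have eC : (β : ℂ) • crossPair (IsLeft L) (G d L) g h =
      ∑ a : LS d L, (if IsBoundary L a.1 then
        ∑ o : Bool, ((β * (g / 4) : ℝ) : ℂ) • cross hL (letterField h a o) (-letterField h a o) a else 0) := by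
    rw [crossPair_eq hL h4, Finset.smul_sum]
    refine Finset.sum_congr rfl fun a _ => ?_
    split_ifs
    · rw [Fintype.sum_bool, smul_add, crossLetter, crossLetter, smul_smul, smul_smul, ← Complex.ofReal_mul]
      simp only [letterField, cond_true, cond_false, cross]
    · rw [smul_zero]
  have hB : ((-(β : ℂ)) • leftBoundary (IsLeft L) (G d L) g h) ⊗ₖ (1 : Matrix (Finset (Orb (RS d L))) _ ℂ) +
      (1 : Matrix (Finset (Orb (LS d L))) _ ℂ) ⊗ₖ ((-(β : ℂ)) • rightBoundary (IsLeft L) (G d L) g h) +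
      (β : ℂ) • crossPair (IsLeft L) (G d L) g h =
      ∑ a : LS d L, if IsBoundary L a.1 then
        ∑ o : Bool, letterTotal hL β g (letterField h a o) (-letterField h a o) a else 0 := by
    rw [eC, eL, eR]
    exact boundary_regroup hL β g _ _
  rw [hs, splitHom_hamiltonian, leftTotal_eq, rightTotal_eq, dlsForm, ← neg_smul_crossTerm hL h4 hβt T hcut,
    ← hB]
  simp only [smul_add, smul_sub, add_kronecker, kronecker_add, smul_kronecker, kronecker_smul]
  module

end Decomposition

/-! ### The two comparison systems -/

section Comparison

variable (hL : Even L) (h4 : 4 ≤ L)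
include hL h4

omit [NeZero L] hL h4 in
/-- `J_V(-β X) = -β J_V(X)` for real `β`. [folklore] -/
private theorem antiConj_neg_ofReal_smul {m' n' : Type*} [Fintype m'] (V : Matrix n' m' ℂ) (β : ℝ)
    (X : Matrix m' m' ℂ) : antiConj V ((-(β : ℂ)) • X) = (-(β : ℂ)) • antiConj V X := by
  rw [antiConj_smul, star_neg, Complex.star_def, Complex.conj_ofReal]

/-- **`Θ(coreL(T, h)) = coreR(amplLL T, h ∘ R)`.** [cite: Koma2022, (5.41), (5.62), (5.95)] [cite: Lieb1994, eq. (4)] -/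
theorem antiConj_thetaT_coreL (U g : ℝ) (T : Fin 2 → FermionTorus (d + 1) L → FermionTorus (d + 1) L → ℂ)
    (h : FermionTorus (d + 1) L → FermionTorus (d + 1) L → ℝ) (B : ℝ) :
    antiConj (thetaT d hL) (coreL T U g h B) =
      coreR (amplLL T) U g (fun x y => h (reflect x) (reflect y)) B := by
  rw [coreL, coreR, antiConj_sub', antiConj_add, antiConj_def, ← rightHamiltonian_amplLL hL (by omega) T U,
    antiConj_thetaT_pairInteraction hL (by omega), antiConj_ofReal_smul, antiConj_thetaT_orderParameter]

/-- **`coreR(T, h) = Θ(coreL(amplRR T, h ∘ R))`.** [cite: Koma2022, (5.41), (5.62), (5.98)] [cite: Lieb1994, eq. (4)] -/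
theorem coreR_eq_antiConj_thetaT (U g : ℝ) (T : Fin 2 → FermionTorus (d + 1) L → FermionTorus (d + 1) L → ℂ)
    (h : FermionTorus (d + 1) L → FermionTorus (d + 1) L → ℝ) (B : ℝ) :
    coreR T U g h B =
      antiConj (thetaT d hL) (coreL (amplRR T) U g (fun x y => h (reflect x) (reflect y)) B) := by
  have hP := antiConj_thetaT_pairInteraction (d := d) hL (by omega) g (fun x y => h (reflect x) (reflect y))
  rw [coreL, coreR, antiConj_sub', antiConj_add, antiConj_def, ← rightHamiltonian_eq_thetaT_amplRR hL (by omega) T U,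
    hP, antiConj_ofReal_smul, antiConj_thetaT_orderParameter,
    pairInteraction_congr (rightGraph (IsLeft L) (G d L))
      (h := fun b b' => h (reflect (reflect b.1)) (reflect (reflect b'.1))) (h' := fun b b' => h b.1 b'.1)
      (fun b b' _ => by simp only [reflect_reflect])]

/-- `Θ` of the left half-bonds of the cut. [cite: Koma2022, (5.80)] -/
theorem antiConj_thetaT_leftBoundary (g : ℝ) (h : FermionTorus (d + 1) L → FermionTorus (d + 1) L → ℝ) :
    antiConj (thetaT d hL) (leftBoundary (IsLeft L) (G d L) g h) =
      ∑ a : LS d L, if IsBoundary L a.1 then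
        ∑ o : Bool, halfBond g (letterField h a o) (leftEquivRight hL a) else 0 := by
  rw [leftBoundary_eq hL h4, antiConj_sum]
  refine Finset.sum_congr rfl fun a _ => ?_
  split_ifs
  · rw [antiConj_add, antiConj_thetaT_halfBond, antiConj_thetaT_halfBond, Fintype.sum_bool]
    rfl
  · exact antiConj_zero _

/-- The right half-bonds of the cut are `Θ` of left half-bonds with the same shifts. [cite: Koma2022, (5.80)] -/
theorem rightBoundary_eq_antiConj_thetaT (g : ℝ) (h : FermionTorus (d + 1) L → FermionTorus (d + 1) L → ℝ) :
    rightBoundary (IsLeft L) (G d L) g h =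
      antiConj (thetaT d hL) (∑ a : LS d L, if IsBoundary L a.1 then
        ∑ o : Bool, halfBond g (-letterField h a o) a else 0) := by
  rw [rightBoundary_eq hL h4, antiConj_sum]
  refine Finset.sum_congr rfl fun a _ => ?_
  split_ifs
  · rw [antiConj_sum, Fintype.sum_bool, antiConj_thetaT_halfBond, antiConj_thetaT_halfBond]
    simp only [letterField, cond_true, cond_false, neg_neg]
  · exact (antiConj_zero _).symm

omit [NeZero L] hL h4 in
/-- A sum over the boundary subtype is an indicator sum over the left sites. [folklore] -/
private theorem sum_boundary_subtype {M : Type*} [AddCommMonoid M] (f : LS d L → M) :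
    ∑ a' : {a : LS d L // IsBoundary L a.1}, f a'.1 = ∑ a : LS d L, if IsBoundary L a.1 then f a else 0 := by
  rw [← Finset.sum_filter]
  exact (Finset.sum_subtype (univ.filter fun a : LS d L => IsBoundary L a.1) (fun a => by simp) f).symm

omit [NeZero L] h4 in
/-- `Σᵢ Mᵢ ⊗ Nᵢ` of the pair letters = the crossing of the cut bonds with shifts `(φ, -φ)`.
[cite: Koma2022, (5.74)] -/
theorem sum_Mpair_kronecker_Npair {β g : ℝ} (hβg : 0 ≤ β * (g / 4))
    (h : FermionTorus (d + 1) L → FermionTorus (d + 1) L → ℝ) :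
    ∑ i : PCutIdx d L, Mpair β g h i ⊗ₖ Npair hL β g h i =
      ∑ a : LS d L, if IsBoundary L a.1 then
        ∑ o : Bool, ((β * (g / 4) : ℝ) : ℂ) • cross hL (letterField h a o) (-letterField h a o) a else 0 := by
  rw [← sum_boundary_subtype, Fintype.sum_prod_type]
  refine Finset.sum_congr rfl fun a' _ => ?_
  rw [Fintype.sum_prod_type]
  refine Finset.sum_congr rfl fun o _ => ?_
  simp only [Mpair, Npair]
  rw [sum_Mletter_kronecker_Nletter hL hβg]
  rfl

omit [NeZero L] h4 in
/-- `Σᵢ Mᵢ ⊗ J_V(Mᵢ)` of the pair letters = the crossing with shifts `(φ, φ)`. [cite: Koma2022, (5.80)] -/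
theorem sum_Mpair_kronecker_antiConj {β g : ℝ} (hβg : 0 ≤ β * (g / 4))
    (h : FermionTorus (d + 1) L → FermionTorus (d + 1) L → ℝ) :
    ∑ i : PCutIdx d L, Mpair β g h i ⊗ₖ antiConj (thetaT d hL) (Mpair β g h i) =
      ∑ a : LS d L, if IsBoundary L a.1 then
        ∑ o : Bool, ((β * (g / 4) : ℝ) : ℂ) • cross hL (letterField h a o) (letterField h a o) a else 0 := by
  rw [← sum_boundary_subtype, Fintype.sum_prod_type]
  refine Finset.sum_congr rfl fun a' _ => ?_
  rw [Fintype.sum_prod_type]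
  refine Finset.sum_congr rfl fun o _ => ?_
  simp only [Mpair, antiConj_thetaT_Mletter]
  rw [sum_Mletter_kronecker_Nletter hL hβg]
  rfl

omit [NeZero L] h4 in
/-- `Σᵢ J_{Vᵀ}(Nᵢ) ⊗ Nᵢ` of the pair letters = the crossing with shifts `(-φ, -φ)`. [cite: Koma2022, (5.80)] -/
theorem sum_antiConj_kronecker_Npair {β g : ℝ} (hβg : 0 ≤ β * (g / 4))
    (h : FermionTorus (d + 1) L → FermionTorus (d + 1) L → ℝ) :
    ∑ i : PCutIdx d L, antiConj (thetaT d hL)ᵀ (Npair hL β g h i) ⊗ₖ Npair hL β g h i =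
      ∑ a : LS d L, if IsBoundary L a.1 then
        ∑ o : Bool, ((β * (g / 4) : ℝ) : ℂ) • cross hL (-letterField h a o) (-letterField h a o) a else 0 := by
  have hV : (thetaT d hL)ᴴ * thetaT d hL = 1 := conjTranspose_thetaMatrix_mul_self _
  rw [← sum_boundary_subtype, Fintype.sum_prod_type]
  refine Finset.sum_congr rfl fun a' _ => ?_
  rw [Fintype.sum_prod_type]
  refine Finset.sum_congr rfl fun o _ => ?_
  simp only [Npair]
  have e : ∀ k, antiConj (thetaT d hL)ᵀ (Nletter hL β g (-letterField h a'.1 o) a'.1 k) =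
      Mletter β g (-letterField h a'.1 o) a'.1 k := fun k => by
    rw [← antiConj_thetaT_Mletter hL, antiConj_transpose_antiConj hV]
  simp only [e]
  rw [sum_Mletter_kronecker_Nletter hL hβg]
  rfl

/-- **The original system in DLS form**: `A ⊗ 1 + 1 ⊗ B + Σᵢ Mᵢ ⊗ Nᵢ = Φ(-βH(T; g, h; B))` with
`A = -βH_L`, `B = -βH_R`, `Mᵢ, Nᵢ` the hopping and pair letters. [cite: Koma2022, (5.63)–(5.64), (5.74)] -/
theorem dls_original {β : ℝ} {tc : Fin 2 → FermionTorus (d + 1) L → ℝ}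
    (hβt : ∀ σ x, IsBoundary L x → 0 ≤ β * tc σ x) {g : ℝ} (hβg : 0 ≤ β * (g / 4)) (U : ℝ)
    (T : Fin 2 → FermionTorus (d + 1) L → FermionTorus (d + 1) L → ℂ)
    (hcut : ∀ σ x, IsBoundary L x → T σ x (reflect x) = tc σ x ∧ T σ (reflect x) x = tc σ x)
    (h : FermionTorus (d + 1) L → FermionTorus (d + 1) L → ℝ) (B : ℝ) :
    ((-(β : ℂ)) • leftTotal (IsLeft L) (G d L) T U g h B) ⊗ₖ (1 : Matrix (Finset (Orb (RS d L))) _ ℂ) +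
        (1 : Matrix (Finset (Orb (LS d L))) _ ℂ) ⊗ₖ ((-(β : ℂ)) • rightTotal (IsLeft L) (G d L) T U g h B) +
        ∑ i : CutIdx d L ⊕ PCutIdx d L,
          Sum.elim (Mfam β tc) (Mpair β g h) i ⊗ₖ Sum.elim (Nfam hL β tc) (Npair hL β g h) i =
      splitHom (IsLeft L) ((-(β : ℂ)) • PairHopRP.hamiltonian (G d L) T U g h B) := by
  have eL : leftBoundary (IsLeft L) (G d L) g h =
      ∑ a : LS d L, if IsBoundary L a.1 then ∑ o : Bool, halfBond g (letterField h a o) a else 0 := by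
    rw [leftBoundary_eq hL h4]
    refine Finset.sum_congr rfl fun a _ => ?_
    split_ifs
    · rw [Fintype.sum_bool]; rfl
    · rfl
  have eR : rightBoundary (IsLeft L) (G d L) g h =
      ∑ a : LS d L, if IsBoundary L a.1 then
        ∑ o : Bool, halfBond g (-letterField h a o) (leftEquivRight hL a) else 0 := by
    rw [rightBoundary_eq hL h4]
    refine Finset.sum_congr rfl fun a _ => ?_
    split_ifs
    · rw [Fintype.sum_bool]
      simp only [letterField, cond_true, cond_false, neg_neg]
    · rfl
  rw [splitHom_neg_smul_hamiltonian hL h4 hβt U g T hcut h B, dlsForm, Fintype.sum_sum_type]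
  simp only [Sum.elim_inl, Sum.elim_inr]
  rw [sum_Mpair_kronecker_Npair hL hβg, leftTotal_eq, rightTotal_eq, eL, eR, ← boundary_regroup]
  simp only [smul_add, add_kronecker, kronecker_add]
  abel

/-- **The first comparison system**: `A ⊗ 1 + 1 ⊗ Θ(A) + Σᵢ Mᵢ ⊗ Θ(Mᵢ) = Φ(-βH(amplLL T; g, h_LL; B))`
— the left half reflected onto the right, ZERO field on the cut bonds.
[cite: Koma2022, Prop. 5.1 (5.65), Cor. 5.2 (5.96)–(5.98)] [cite: DLS1978, Lemma 4.1] -/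
theorem dls_left {β : ℝ} {tc : Fin 2 → FermionTorus (d + 1) L → ℝ}
    (hβt : ∀ σ x, IsBoundary L x → 0 ≤ β * tc σ x) {g : ℝ} (hβg : 0 ≤ β * (g / 4)) (U : ℝ)
    (T : Fin 2 → FermionTorus (d + 1) L → FermionTorus (d + 1) L → ℂ)
    (hT : ∀ σ x y, T σ y x = star (T σ x y)) (hcut : ∀ σ x, IsBoundary L x → T σ x (reflect x) = tc σ x)
    (h : FermionTorus (d + 1) L → FermionTorus (d + 1) L → ℝ) (B : ℝ) :
    ((-(β : ℂ)) • leftTotal (IsLeft L) (G d L) T U g h B) ⊗ₖ (1 : Matrix (Finset (Orb (RS d L))) _ ℂ) +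
        (1 : Matrix (Finset (Orb (LS d L))) _ ℂ) ⊗ₖ
          antiConj (thetaT d hL) ((-(β : ℂ)) • leftTotal (IsLeft L) (G d L) T U g h B) +
        ∑ i : CutIdx d L ⊕ PCutIdx d L,
          Sum.elim (Mfam β tc) (Mpair β g h) i ⊗ₖ
            antiConj (thetaT d hL) (Sum.elim (Mfam β tc) (Mpair β g h) i) =
      splitHom (IsLeft L) ((-(β : ℂ)) • PairHopRP.hamiltonian (G d L) (amplLL T) U g (fieldLL h) B) := by
  -- Step 1: the left-hand side in DLS form with shifts `(φ, φ)`
  have eL : leftBoundary (IsLeft L) (G d L) g h =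
      ∑ a : LS d L, if IsBoundary L a.1 then ∑ o : Bool, halfBond g (letterField h a o) a else 0 := by
    rw [leftBoundary_eq hL h4]
    refine Finset.sum_congr rfl fun a _ => ?_
    split_ifs
    · rw [Fintype.sum_bool]; rfl
    · rfl
  have e1 : ((-(β : ℂ)) • leftTotal (IsLeft L) (G d L) T U g h B) ⊗ₖ (1 : Matrix (Finset (Orb (RS d L))) _ ℂ) +
        (1 : Matrix (Finset (Orb (LS d L))) _ ℂ) ⊗ₖ
          antiConj (thetaT d hL) ((-(β : ℂ)) • leftTotal (IsLeft L) (G d L) T U g h B) +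
        ∑ i : CutIdx d L ⊕ PCutIdx d L,
          Sum.elim (Mfam β tc) (Mpair β g h) i ⊗ₖ
            antiConj (thetaT d hL) (Sum.elim (Mfam β tc) (Mpair β g h) i) =
      dlsForm hL β tc (amplLL T) U g h (fun x y => h (reflect x) (reflect y)) B
        (fun a o => letterField h a o) (fun a o => letterField h a o) := by
    rw [Fintype.sum_sum_type]
    simp only [Sum.elim_inl, Sum.elim_inr, antiConj_thetaT_Mfam]
    rw [sum_Mpair_kronecker_antiConj hL hβg, leftTotal_eq, antiConj_neg_ofReal_smul, antiConj_add,
      antiConj_thetaT_coreL hL h4, antiConj_thetaT_leftBoundary hL h4, eL, dlsForm, ← boundary_regroup,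
      coreL, coreL, leftHamiltonian_amplLL]
    simp only [smul_add, add_kronecker, kronecker_add]
    abel
  -- Step 2: the right-hand side in DLS form with shifts `(0, 0)`
  have hcut' := cut_both_amplLL (d := d) h4 hT hcut
  rw [e1, splitHom_neg_smul_hamiltonian hL h4 hβt U g (amplLL T) hcut' (fieldLL h) B]
  refine dlsForm_congr hL β tc (amplLL T) U g B (fun x y hx hy => (fieldLL_of_left h hx hy).symm)
    (fun x y hx hy => (fieldLL_of_right h hx hy).symm) (fun a ha o => ?_)
  have hc := fieldLL_of_cut h (a.2) ((leftEquivRight hL a).2)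
  rw [letterTotal_diag]
  cases o
  · simp only [letterField, cond_false, leftEquivRight_apply] at hc ⊢
    rw [hc.2, neg_zero, neg_zero, ← letterTotal_diag hL β g 0 a]
  · simp only [letterField, cond_true, leftEquivRight_apply] at hc ⊢
    rw [hc.1, neg_zero]

/-- **The second comparison system**: `Θ'(B) ⊗ 1 + 1 ⊗ B + Σᵢ Θ'(Nᵢ) ⊗ Nᵢ = Φ(-βH(amplRR T; g, h_RR; B))`.
[cite: Koma2022, Prop. 5.1 (5.65), Cor. 5.2 (5.93)–(5.95)] [cite: DLS1978, Lemma 4.1] -/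
theorem dls_right {β : ℝ} {tc : Fin 2 → FermionTorus (d + 1) L → ℝ}
    (hβt : ∀ σ x, IsBoundary L x → 0 ≤ β * tc σ x) {g : ℝ} (hβg : 0 ≤ β * (g / 4)) (U : ℝ)
    (T : Fin 2 → FermionTorus (d + 1) L → FermionTorus (d + 1) L → ℂ)
    (hT : ∀ σ x y, T σ y x = star (T σ x y)) (hcut : ∀ σ x, IsBoundary L x → T σ x (reflect x) = tc σ x)
    (h : FermionTorus (d + 1) L → FermionTorus (d + 1) L → ℝ) (B : ℝ) :
    antiConj (thetaT d hL)ᵀ ((-(β : ℂ)) • rightTotal (IsLeft L) (G d L) T U g h B) ⊗ₖ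
          (1 : Matrix (Finset (Orb (RS d L))) _ ℂ) +
        (1 : Matrix (Finset (Orb (LS d L))) _ ℂ) ⊗ₖ ((-(β : ℂ)) • rightTotal (IsLeft L) (G d L) T U g h B) +
        ∑ i : CutIdx d L ⊕ PCutIdx d L,
          antiConj (thetaT d hL)ᵀ (Sum.elim (Nfam hL β tc) (Npair hL β g h) i) ⊗ₖ
            Sum.elim (Nfam hL β tc) (Npair hL β g h) i =
      splitHom (IsLeft L) ((-(β : ℂ)) • PairHopRP.hamiltonian (G d L) (amplRR T) U g (fieldRR h) B) := by
  have hV : (thetaT d hL)ᴴ * thetaT d hL = 1 := conjTranspose_thetaMatrix_mul_self _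
  have eR : rightBoundary (IsLeft L) (G d L) g h =
      ∑ a : LS d L, if IsBoundary L a.1 then
        ∑ o : Bool, halfBond g (-letterField h a o) (leftEquivRight hL a) else 0 := by
    rw [rightBoundary_eq hL h4]
    refine Finset.sum_congr rfl fun a _ => ?_
    split_ifs
    · rw [Fintype.sum_bool]
      simp only [letterField, cond_true, cond_false, neg_neg]
    · rfl
  have eN : ∀ i : CutIdx d L, antiConj (thetaT d hL)ᵀ (Nfam hL β tc i) = Mfam β tc i := fun i => by
    rw [← antiConj_thetaT_Mfam hL, antiConj_transpose_antiConj hV]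
  have eB : antiConj (thetaT d hL)ᵀ ((-(β : ℂ)) • rightTotal (IsLeft L) (G d L) T U g h B) =
      (-(β : ℂ)) • (coreL (amplRR T) U g (fun x y => h (reflect x) (reflect y)) B +
        ∑ a : LS d L, if IsBoundary L a.1 then ∑ o : Bool, halfBond g (-letterField h a o) a else 0) := by
    rw [rightTotal_eq, coreR_eq_antiConj_thetaT hL h4, rightBoundary_eq_antiConj_thetaT hL h4, ← antiConj_add,
      ← antiConj_neg_ofReal_smul, antiConj_transpose_antiConj hV]
  have e1 : antiConj (thetaT d hL)ᵀ ((-(β : ℂ)) • rightTotal (IsLeft L) (G d L) T U g h B) ⊗ₖ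
          (1 : Matrix (Finset (Orb (RS d L))) _ ℂ) +
        (1 : Matrix (Finset (Orb (LS d L))) _ ℂ) ⊗ₖ ((-(β : ℂ)) • rightTotal (IsLeft L) (G d L) T U g h B) +
        ∑ i : CutIdx d L ⊕ PCutIdx d L,
          antiConj (thetaT d hL)ᵀ (Sum.elim (Nfam hL β tc) (Npair hL β g h) i) ⊗ₖ
            Sum.elim (Nfam hL β tc) (Npair hL β g h) i =
      dlsForm hL β tc (amplRR T) U g (fun x y => h (reflect x) (reflect y)) h B
        (fun a o => -letterField h a o) (fun a o => -letterField h a o) := by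
    rw [Fintype.sum_sum_type]
    simp only [Sum.elim_inl, Sum.elim_inr, eN]
    rw [sum_antiConj_kronecker_Npair hL hβg, eB, rightTotal_eq, eR, dlsForm, ← boundary_regroup, coreR, coreR,
      rightHamiltonian_amplRR]
    simp only [smul_add, add_kronecker, kronecker_add]
    abel
  have hcut' := cut_both_amplRR (d := d) hL h4 hT hcut
  rw [e1, splitHom_neg_smul_hamiltonian hL h4 hβt U g (amplRR T) hcut' (fieldRR h) B]
  refine dlsForm_congr hL β tc (amplRR T) U g B (fun x y hx hy => (fieldRR_of_left h hx hy).symm)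
    (fun x y hx hy => (fieldRR_of_right h hx hy).symm) (fun a ha o => ?_)
  have hc := fieldRR_of_cut h (a.2) ((leftEquivRight hL a).2)
  rw [letterTotal_diag]
  cases o
  · simp only [letterField, cond_false, leftEquivRight_apply] at hc ⊢
    rw [hc.2, neg_zero, neg_zero, ← letterTotal_diag hL β g 0 a]
  · simp only [letterField, cond_true, leftEquivRight_apply] at hc ⊢
    rw [hc.1, neg_zero]

end Comparison

/-! ### The reflection-positivity inequality -/

section Main

variable (hL : Even L) (h4 : 4 ≤ L)
include hL h4

omit [NeZero L] hL h4 in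
/-- `Z_β(H) > 0` for the (Hermitian) pair-hopping Hamiltonian. [cite: Koma2022, (2.10)] -/
theorem partitionFn_hamiltonian_re_pos (T : Fin 2 → FermionTorus (d + 1) L → FermionTorus (d + 1) L → ℂ)
    (hT : ∀ σ x y, T σ y x = star (T σ x y)) (U g : ℝ)
    (h : FermionTorus (d + 1) L → FermionTorus (d + 1) L → ℝ) (B β : ℝ) :
    0 < ((PairHopRP.hamiltonian (G d L) T U g h B).partitionFn β).re := by
  haveI : Nonempty (Finset (Orb (FermionTorus (d + 1) L))) := ⟨∅⟩
  rw [(hamiltonian_isHermitian (G d L) T hT U g h B).partitionFn_eq_ofReal, Complex.ofReal_re]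
  exact (hamiltonian_isHermitian (G d L) T hT U g h B).sum_exp_pos β

omit [NeZero L] hL h4 in
/-- `‖Z_β(H)‖ = Re Z_β(H)` (the partition function of a Hermitian matrix is a positive real). [cite: Koma2022, (2.10)] -/
theorem norm_partitionFn_hamiltonian (T : Fin 2 → FermionTorus (d + 1) L → FermionTorus (d + 1) L → ℂ)
    (hT : ∀ σ x y, T σ y x = star (T σ x y)) (U g : ℝ)
    (h : FermionTorus (d + 1) L → FermionTorus (d + 1) L → ℝ) (B β : ℝ) :
    ‖(PairHopRP.hamiltonian (G d L) T U g h B).partitionFn β‖ =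
      ((PairHopRP.hamiltonian (G d L) T U g h B).partitionFn β).re := by
  rw [(hamiltonian_isHermitian (G d L) T hT U g h B).partitionFn_eq_ofReal, Complex.ofReal_re,
    Complex.norm_real, Real.norm_of_nonneg]
  rw [← Complex.ofReal_re (∑ i, Real.exp (-(β * (hamiltonian_isHermitian (G d L) T hT U g h B).eigenvalues i))),
    ← (hamiltonian_isHermitian (G d L) T hT U g h B).partitionFn_eq_ofReal]
  exact (partitionFn_hamiltonian_re_pos T hT U g h B β).le

/-- **Reflection positivity for lattice fermions with BCS pair hopping (Koma 2022, Prop. 5.1 /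
Cor. 5.2, in Lieb's reflection frame).** On the even torus `(ℤ/Lℤ)^{d+1}` (`L ≥ 4`, any `d`) cut
perpendicular to coordinate `0`, for `β ≥ 0`, pair-hopping strength `g ≥ 0`, any real `U` and
source `B`, Hermitian hopping amplitudes `T` that are real and nonnegative (`tc σ l ≥ 0`, bond and
spin dependent) on the cut bonds, and ANY real field configuration `h` on the ordered bonds:

  `Z_β(T; g, h; B)² ≤ Z_β(amplLL T; g, h_LL; B) · Z_β(amplRR T; g, h_RR; B)`,

where `amplLL T` / `amplRR T` keep the left / right hopping and reflect it to the other side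
(Lieb's `Θ(H_L)`, `Θ(H_R)`), and `h_LL` / `h_RR` keep the left / right bond fields, transport them
by the reflection to the other side, and VANISH on the cut bonds — Koma's `h⁻`, `h⁺` of
(5.93)–(5.98). [cite: Koma2022, Prop. 5.1 (5.65), Cor. 5.2 (5.92), (5.99)] [cite: Lieb1994, Lemma, eq. (6)] [cite: DLS1978, Lemma 4.1] -/
theorem partitionFn_sq_le_reflected {β : ℝ} (hβ : 0 ≤ β) {g : ℝ} (hg : 0 ≤ g)
    {tc : Fin 2 → FermionTorus (d + 1) L → ℝ} (htc : ∀ σ x, IsBoundary L x → 0 ≤ tc σ x) (U : ℝ)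
    (T : Fin 2 → FermionTorus (d + 1) L → FermionTorus (d + 1) L → ℂ)
    (hT : ∀ σ x y, T σ y x = star (T σ x y)) (hcut : ∀ σ x, IsBoundary L x → T σ x (reflect x) = tc σ x)
    (h : FermionTorus (d + 1) L → FermionTorus (d + 1) L → ℝ) (B : ℝ) :
    ((PairHopRP.hamiltonian (G d L) T U g h B).partitionFn β).re ^ 2 ≤
      ((PairHopRP.hamiltonian (G d L) (amplLL T) U g (fieldLL h) B).partitionFn β).re *
        ((PairHopRP.hamiltonian (G d L) (amplRR T) U g (fieldRR h) B).partitionFn β).re := by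
  have hβt : ∀ σ x, IsBoundary L x → 0 ≤ β * tc σ x := fun σ x hx => mul_nonneg hβ (htc σ x hx)
  have hβg : 0 ≤ β * (g / 4) := mul_nonneg hβ (by linarith)
  -- unitarity of `V = Θ` and of `Vᵀ`
  have hV : (thetaT d hL)ᴴ * thetaT d hL = 1 := conjTranspose_thetaMatrix_mul_self _
  have hV' : thetaT d hL * (thetaT d hL)ᴴ = 1 := thetaMatrix_mul_conjTranspose _
  have hW : ((thetaT d hL)ᵀ)ᴴ * (thetaT d hL)ᵀ = 1 := conjTranspose_transpose_mul_transpose hV'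
  have hW' : (thetaT d hL)ᵀ * ((thetaT d hL)ᵀ)ᴴ = 1 := transpose_mul_conjTranspose_transpose hV
  -- the DLS inequality for the decomposition of `-βH`, read back through `Φ`
  have hDLS := Matrix.norm_trace_exp_kroneckerSum_le_antiConj
    ((-(β : ℂ)) • leftTotal (IsLeft L) (G d L) T U g h B)
    ((-(β : ℂ)) • rightTotal (IsLeft L) (G d L) T U g h B)
    (Sum.elim (Mfam β tc) (Mpair β g h)) (Sum.elim (Nfam hL β tc) (Npair hL β g h)) hV hV' hW hW'
  rw [dls_original hL h4 hβt hβg U T (cut_both hT hcut) h B, dls_left hL h4 hβt hβg U T hT hcut h B,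
    dls_right hL h4 hβt hβg U T hT hcut h B, ← LiebRP.partitionFn_eq_trace_exp_splitHom,
    ← LiebRP.partitionFn_eq_trace_exp_splitHom, ← LiebRP.partitionFn_eq_trace_exp_splitHom,
    norm_partitionFn_hamiltonian T hT U g h B β] at hDLS
  -- square it
  have hposLL := (partitionFn_hamiltonian_re_pos (amplLL T) (amplLL_herm hT) U g (fieldLL h) B β).le
  have hposRR := (partitionFn_hamiltonian_re_pos (amplRR T) (amplRR_herm hT) U g (fieldRR h) B β).le
  have hpos := (partitionFn_hamiltonian_re_pos T hT U g h B β).le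
  calc ((PairHopRP.hamiltonian (G d L) T U g h B).partitionFn β).re ^ 2
      ≤ (Real.sqrt ((PairHopRP.hamiltonian (G d L) (amplLL T) U g (fieldLL h) B).partitionFn β).re *
          Real.sqrt ((PairHopRP.hamiltonian (G d L) (amplRR T) U g (fieldRR h) B).partitionFn β).re) ^ 2 :=
        pow_le_pow_left₀ hpos hDLS 2
    _ = ((PairHopRP.hamiltonian (G d L) (amplLL T) U g (fieldLL h) B).partitionFn β).re *
          ((PairHopRP.hamiltonian (G d L) (amplRR T) U g (fieldRR h) B).partitionFn β).re := by
        rw [mul_pow, Real.sq_sqrt hposLL, Real.sq_sqrt hposRR]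

/-- **The `β → ∞` form** (Lieb's Remark (iii) / Lieb–Nachtergaele's Lemma 3.1 for the lowest
eigenvalue): `E₀(amplLL T; h_LL) + E₀(amplRR T; h_RR) ≤ 2 E₀(T; h)` over all of Fock space, for
`g ≥ 0`, nonnegative real cut amplitudes and any field `h`, source `B`, interaction `U`.
[cite: Koma2022, (2.13) and Prop. 5.1] [cite: Lieb1994, Remark (iii)] [cite: LiebNachtergaele1995, Lemma 3.1] -/
theorem groundEnergy_add_le_two_mul {g : ℝ} (hg : 0 ≤ g)
    {tc : Fin 2 → FermionTorus (d + 1) L → ℝ} (htc : ∀ σ x, IsBoundary L x → 0 ≤ tc σ x) (U : ℝ)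
    (T : Fin 2 → FermionTorus (d + 1) L → FermionTorus (d + 1) L → ℂ)
    (hT : ∀ σ x y, T σ y x = star (T σ x y)) (hcut : ∀ σ x, IsBoundary L x → T σ x (reflect x) = tc σ x)
    (h : FermionTorus (d + 1) L → FermionTorus (d + 1) L → ℝ) (B : ℝ) :
    (PairHopRP.hamiltonian (G d L) (amplLL T) U g (fieldLL h) B).groundEnergy +
        (PairHopRP.hamiltonian (G d L) (amplRR T) U g (fieldRR h) B).groundEnergy ≤
      2 * (PairHopRP.hamiltonian (G d L) T U g h B).groundEnergy :=
  haveI : Nonempty (Finset (Orb (FermionTorus (d + 1) L))) := ⟨∅⟩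
  Matrix.groundEnergy_add_le_two_mul_of_partitionFn_sq_le
    (hamiltonian_isHermitian (G d L) T hT U g h B)
    (hamiltonian_isHermitian (G d L) (amplLL T) (amplLL_herm hT) U g (fieldLL h) B)
    (hamiltonian_isHermitian (G d L) (amplRR T) (amplRR_herm hT) U g (fieldRR h) B)
    (fun _ hβ' => partitionFn_sq_le_reflected hL h4 hβ'.le hg htc U T hT hcut h B)

end Main

end PairHopCutRP

end Literature.MathematicalPhysics.QuantumLattice

end
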